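/-
Copyright: lit-balaban Phase-2 proof seat p27 (gen 36).  Statement-level skeleton of a published paper; no proof claims beyond what the
kernel checks below.
-/
import Literature.MathematicalPhysics.QuantumFieldTheory.BalabanImbrieJaffe1984to88.BIJ88FreeNeumannLaplacianRegion
import Literature.MathematicalPhysics.QuantumFieldTheory.BalabanImbrieJaffe1984to88.BIJ85FreeResolventTiltedRow
import Literature.MathematicalPhysics.QuantumFieldTheory.BalabanImbrieJaffe1984to88.BIJ85TorusTentCutoff
import Literature.MathematicalPhysics.QuantumFieldTheory.BalabanImbrieJaffe1984to88.BIJ88NeumannPropagatorSmallFieldRegion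

/-!
# [Balaban1983RegularityDecay] = [6] (1.10) p. 573 / [BalabanImbrieJaffe1988] (2.30) p. 263 — **THE FREE TILTED ROW OF THE MASSIVE
# NEUMANN RESOLVENT `R_Ω = (L^{2k}(−Δ^N_Ω) + 1)⁻¹` OF A GENERAL REGION `Ω ⊆ T^{(0)}` AT DEEP ROWS:
# `Σ_z (e^{t|x−z|_∞/L^k}R_Ω(x,z))² ≤ C₀L^{−kd}` for every site `x` whose sup-ball of radius `2L^k + 1` lies in `Ω`**
# — the `ℓ² → ℓ^∞` smoothing input of the `k`-uniform OPERATOR-FORM (1.10) value member for the REGION Neumann propagators `G_k(Ω,u)`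
# (front (α′) of `HOME/lit-balaban-r18/C2S14-CLOSURE.md`), by COMPARISON WITH THE TORUS; built on p34's `lapN` (file
# `BIJ88FreeNeumannLaplacianRegion`, the free Neumann Laplacian of a region with its minimum principle / comparison / symmetry).

T. Bałaban, *Regularity and decay of lattice Green's functions*, Commun. Math. Phys. **89** (1983) 571–597 [Balaban1983RegularityDecay]
(= [6] of [BalabanImbrieJaffe1988], [7] of [BalabanImbrieJaffe1985]), Theorem p. 573 (1.10); T. Bałaban, J. Imbrie, A. Jaffe, *Effective
action and cluster properties of the abelian Higgs model*, Commun. Math. Phys. **114** (1988) 257–315 [BalabanImbrieJaffe1988], (2.30)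
p. 263; T. Bałaban, *(Higgs)₂,₃ quantum fields in a finite volume III. Renormalization*, Commun. Math. Phys. **88** (1983) 411–445
[Balaban1983Higgs3], (2.10) p. 426 (the multiscale kernel bounds of the flat block propagator, p20's `B3Sect3KernelsZeroTorus.gpiece_bounds`).

statement-level skeleton of published theorems with citation tags; proofs where landed; nothing here is a claim about the Yang–Mills mass gap

PDF held: `paper:balaban1988-cmp114-bij-abelian-higgs-effective-action` (journal page = PDF page + 256), p. 263 [PDF 7]; [6] (1.10) as
transcribed in the tree's `Balaban1983to89.B4Thm110ZeroTorus`; [Balaban1983Higgs3] (2.10) p. 426 as consumed through `gpiece_bounds`.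

CITATION HEADER (lean-in-tree rule).  Part of the lit-balaban TYPED SKELETON (HOME `run/shared/lean/pub/lit-balaban/`), PHASE-2 proof seat
p27 gen 36 (unit `lit-balaban-p27-g36`; TAKING line HOME/STATUS.md 2026-08-23T05:06:35Z, free-target protocol G.5-34(d), the DEEP-ROW
sub-item of front (α′) — the every-`x` form of the same input is p34 gen 18's TAKING 04:22:50Z (`BIJ88BlockPoincareNash` /
`BIJ88FreeNeumannResolventRegionTiltedRow`, discrete Nash–Davies iteration) and SUPERSEDES the present theorem in strength when it lands;
the two statements differ by the depth hypothesis, so neither restates the other).  WHAT IS REPRODUCED: a located INPUT of the located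
members of row **C2.Eq2.30** (`HOME/lit-balaban-r18/ROWS-C2.md`, owner r18) and row **C1.Eq7.3.1-7.3.2** (`HOME/lit-balaban-r15/ROWS-C1.md`,
owner r15): the free tilted row that p27 gen 34's sup-norm route (`BIJ88NeumannPropagatorSmallFieldSupDecay.decay110_smallField_cube`: Kato
→ comparison principle → Cauchy–Schwarz → Agmon) needs for a GENERAL region `Ω` in place of a cube — there the input came from [6]'s
multiscale BOX pieces (`BIJ88FreeNeumannResolventBox.tilted_row_boxR_sq_le`), which have no analogue for a general block union.  No head
changes.  Kind «model-level theorems only» (no definition, no `Prop`-valued fact).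

THE PRINTED TEXT (verbatim).  [6] p. 573 (as transcribed in `B4Thm110ZeroTorus`): *"|(D^η_{A,μ}G_k(Ω, A)f)(x)|, |(G_k(Ω, A)f)(x)| ≤
c₀exp(−δ₀ dist(x, supp f))‖f‖_∞ (1.10)"*, for *"x ∈ Ω"* with *"dist({x,x′}, Ω^c) ≥ R₀"* (general regions `Ω` that are unions of big
blocks).  C2 p. 263 [PDF 7]: *"a straightforward application of the random walk expansion of [6] shows that |(G_{k,loc}(u)f)(x)| ≦ ce^{−c
dist(suppt f,x)}‖f‖_∞, (2.30)"*.

THE OBJECTS (all with bodies elsewhere; nothing defined here).  The fine torus `T^{(0)} = Site P 0` of the series `Params` (`2L^{m+K}` sites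
per direction, spacing `ε`), its sup-distance `supDist`; p34's free Neumann Laplacian of a region `lapN Ω = Σ_{b∈Ω*}v_bv_bᵀ` in lattice units
and the massive operator `M_s = s·lapN Ω + 1` with `s = n²`, `n = L^k` (so that `M_s⁻¹ = R_Ω := (L^{2k}(−Δ^N_Ω) + 1)⁻¹`, row sums `1`,
entries `≥ 0`, symmetric); pv07's flat block propagator `G_k(T_ε,0) = (tower P a 0).G k` (used at `a = 1`) with the block average `Q_k^*Q_k`;
p30's product-tent cutoff `χ_{x,r} = chi x r` (`= 1` on the sup-ball of radius `r`, `= 0` off radius `2r − 1`, `1/r`-Lipschitz along bonds).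

THE MECHANISM (ours; DIVERGENCE OF METHOD from [6]'s random-walk expansion disclosed).  Fix a site `x` with `B_∞(x, 2n+1) ⊆ Ω`, put
`ū = G_k(T_ε,0)(·,x)` and `χ = χ_{x,n}`.  (§3) Since `χ` and its neighbours live inside `Ω`, the Neumann cut carries no `χ`:
`lapN Ω(χū) = lapN T(χū)` (`lapN_mulVec_chi_mul_eq`); with the column equation `n²(lapN T ū) + a_kQ_k^*Q_kū = (L^kε)²δ_x`
(`tower_col_equation`) and the first-order commutator `[lapN T, χ]ū` (`lapN_univ_commutator`) this gives the EXACT IDENTITY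
`(L^kε)²R_Ω(x,·) = χū − R_Ω[χ(ū − a_kQ_k^*Q_kū)] − R_Ω[n²[lapN T,χ]ū]`, and the commutator splits as a bond DIVERGENCE `Σ_b(D_bm_b)v_b` plus a
symmetric remainder `c_E` with `D_b = χ(b₊) − χ(b₋)` (`|D_b| ≤ 1/n`, supported on the annulus `n−1 ≤ |x−b₋|_∞ ≤ 2n`),
`m_b = ½(ū(b₋)+ū(b₊))`, `c_E` built from `D_b·½(ū(b₊) − ū(b₋))` (`commutator_decomposition`).  (§2) THE WEIGHTED ENERGY INEQUALITY (the
one new estimate): for `f + n²Λ_Bf = g + n²div_BF` and a positive weight `w` with squared bond oscillation `≤ κw(b₋)w(b₊)`, squared ratio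
`≤ ρ`, `8n²κd(1+ρ) ≤ 1`: `Σ(wf)² ≤ 2Σ(wg)² + 5n²Σ_b½(w(b₋)²+w(b₊)²)F_b²` — test the equation against `w²f`; the divergence source costs ONE
power of `n` (`energy_weighted`).  (§1) Far from the diagonal the flat block propagator has bond differences `≤ C_B(L^kε)²L^{−kd}/L^k`
(`annulus_diff_bound`, from the (2.10) pieces `|∂G^η_{(i)}| ≤ C(L^iε)^{1−d}e^{−δ|·|/L^i}` and the scale sum `Σ_jL^{jp}e^{−δL^j} < ∞`).  (§4) With
the weight `w = e^{t|x−·|_∞/n}`: `Σ(wχū)² ≤` p27's torus tilted row `tilted_row_G_sq_le`; the `χ(ū − a_kQ^*Qū)` term by the energy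
inequality with `F = 0` and `tilted_sq_QQ_le`; the commutator term by the energy inequality with `F = D·m` (`Σ_b w̄²F² ≲ n^{−2}Σ(wū)²`) and
`g = −n²c_E` (`|c_E| ≤ 2dK`, `K = C_B(L^kε)²/(2L^{kd}n³)`, supported in the ball of radius `2n+1`, `(4n+3)^d ≤ 7^dL^{kd}` sites) — every term is
`≲ (L^kε)⁴L^{−kd}`, and `(L^kε)⁴` cancels.

WHAT IS PROVED (theorems only; 0 `sorry`; standard axioms; no new definition, no `Prop`-valued fact).
* §1 (private `pow_mul_exp_neg_le`, `rpow_two_sub_natCast`, `rpow_one_sub_natCast`, `exp_piece_le`), **`scale_sum_le`** (`Σ_{i<k}(L^{k−i})^pe^{−δ(L^k−1)/L^i} ≤ e^δ(p+1)!δ^{−(p+1)}/(L−1)`), `towerG_eq_sum_gpiece`,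
  **`annulus_value_bound`** (`|G_k(T_ε,0)(z,x)| ≤ C_A(L^kε)²L^{−kd}` for `|x−z|_∞ ≥ L^k − 1`), **`annulus_diff_bound`** (bond differences
  `≤ C_B(L^kε)²L^{−kd}/L^k`), every volume, `1 ≤ k ≤ K`.
* §2 `sum_mul_sum_bvec` (summation by parts), `sum_src_le`/`sum_tgt_le`, (private `bond_energy_lower`, `bond_div_upper`), **`energy_weighted`**.
* §3 `sum_ite_src_eq`/`sum_ite_tgt_eq`, `lapN_univ_mulVec_apply`, `H_zero_mulVec_apply`, **`tower_col_equation`**, **`lapN_univ_commutator`**,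
  **`lapN_mulVec_chi_mul_eq`**, **`commutator_decomposition`**.
* §4 (private `sq_half_sum_le`, `sub_sub_sq_le`, `sub_mul_sq_le`, `weight_cross_le`), `weight_ratio_sq`, **`tilted_row_regionR_sq_le_deep`** — for `1 ≤ d ≤ 3`, odd `L > 1`: `∃ t₀, C₀ > 0` (from `d, L`) such that for
  every `P` with these `d, L`, every `1 ≤ k ≤ K` with `4L^k + 6 ≤ |T|`, every `Ω`, every `x` with `B_∞(x, 2L^k+1) ⊆ Ω`, every `0 ≤ t ≤ t₀`:
  `Σ_z (e^{t|x−z|_∞/L^k}·((L^k)²·lapN Ω + 1)⁻¹(x,z))² ≤ C₀/L^{kd}`.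

HONEST SCOPE.  (i) DEEP ROWS ONLY (`B_∞(x, 2L^k+1) ⊆ Ω` — [6]'s restriction `dist(x, Ω^c) ≥ R₀` in block units with `R₀ = 3`); the
every-row form is p34 gen 18's (α′) programme, which supersedes this file in strength.  (ii) Free-lattice analysis only (no gauge field);
the small-field operator-form member for `G_k(Ω,u)` at deep rows follows by p27 gen 34's §4 with this input (p34's file B of the (α′)
TAKING, or a successor).  (iii) `d ≤ 3`, odd `L`, `k ≤ K` come from the torus pieces `gpiece_bounds`; constants ours and explicit.  (iv) The
value bound `annulus_value_bound` is recorded but not used by §4 (only the bond differences enter).  Nothing here is summit progress.  Unit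
`lit-balaban-p27` (literature-prover-lit-balaban-p27-g36-0), HOME `run/shared/lean/pub/lit-balaban/`, 2026-08-23.
-/

open scoped BigOperators
open Finset Matrix

namespace Literature.MathematicalPhysics.QuantumFieldTheory.BalabanImbrieJaffe1984to88.BIJ88FreeNeumannResolventRegionDeep

open Literature.MathematicalPhysics.QuantumFieldTheory.Balaban1983to89
open B1RG242Torus (H tower)
open LatticeFieldCalculus (supDist shiftEquiv)
open BIJ88Sect3Statements (starB mem_starB)
open BIJ88FreeNeumannLaplacianRegion (bvec lapN lapN_mulVec_apply lapN_mulVec_eq_sum massOp_mulVec_apply massOp_mul_inv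
  inv_mul_massOp inv_massOp_transpose bvec_apply sum_bvec_mul)
open BIJ85TorusTentCutoff (chi chi_nonneg chi_le_one chi_eq_one_of_supDist_le supDist_lt_of_chi_ne_zero abs_chi_shift_sub_le
  le_supDist_of_chi_shift_ne supDist_le_of_chi_shift_ne supDist_shift_le_succ supDist_le_shift_succ supDist_unshift_le_succ ball mem_ball
  card_ball_le)
open BIJ85FreeResolventTorus (tilted_sq_QQ_le weight_block_osc abs_supDist_shift_sub_le)
open BIJ85FreeResolventTiltedRow (tilted_row_G_sq_le)
open BIJ88NeumannPropagatorSmallFieldRegion (weight_bond_osc_sq)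

noncomputable section

variable {P : Params}

/-! ## §1. Scale sums, and the flat block propagator `G_k(T_ε,0)` far from the diagonal

The (2.10) pieces of [Balaban1983Higgs3] (p20's `gpiece_bounds`: value `≤ C(L^iε)^{2−d}e^{−δ|·|/L^i}`, bond differences
`≤ C(L^iε)^{1−d}e^{−δ|·|/L^i}`) summed over the scales `i < k` at distance `≥ L^k − 1` from the diagonal. -/

/-- kernel: `x^p e^{-δ x} ≤ (p+1)!/(δ^{p+1} x)` for `x > 0`, `δ > 0`. [folklore] -/
private theorem pow_mul_exp_neg_le {x δ : ℝ} (hx : 0 < x) (hδ : 0 < δ) (p : ℕ) :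
    x ^ p * Real.exp (-(δ * x)) ≤ (p + 1).factorial / (δ ^ (p + 1) * x) := by
  have h1 : (δ * x) ^ (p + 1) / (p + 1).factorial ≤ Real.exp (δ * x) :=
    Real.pow_div_factorial_le_exp _ (by positivity) _
  have hfac : (0 : ℝ) < (p + 1).factorial := by exact_mod_cast Nat.factorial_pos _
  have hδx : 0 < δ * x := mul_pos hδ hx
  rw [div_le_iff₀ hfac] at h1
  rw [Real.exp_neg, le_div_iff₀ (by positivity)]
  -- `x^p e^{-δx} δ^{p+1} x = (δx)^{p+1} x^... ` : x^p * δ^(p+1) * x = (δ x)^(p+1)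
  have e : x ^ p * (Real.exp (δ * x))⁻¹ * (δ ^ (p + 1) * x) = (δ * x) ^ (p + 1) * (Real.exp (δ * x))⁻¹ := by
    rw [mul_pow]; ring
  rw [e]
  calc (δ * x) ^ (p + 1) * (Real.exp (δ * x))⁻¹ ≤ (Real.exp (δ * x) * (p + 1).factorial) * (Real.exp (δ * x))⁻¹ :=
        mul_le_mul_of_nonneg_right h1 (inv_nonneg.2 (Real.exp_pos _).le)
    _ = (p + 1).factorial := by field_simp

/-- kernel: the scale sum `Σ_{i<k} (L^{k-i})^p e^{-δ(L^k-1)/L^i} ≤ e^δ (p+1)! δ^{-(p+1)}/(L-1)`, uniformly in `k` (the sum over the scales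
`i < k` of the (2.10) pieces at distance `≥ L^k − 1`). [cite: Balaban1983Higgs3, (2.10) p.426] -/
theorem scale_sum_le {L : ℝ} (hL : 1 < L) {δ : ℝ} (hδ : 0 < δ) (p k : ℕ) :
    ∑ i ∈ range k, (L ^ (k - i)) ^ p * Real.exp (-(δ * (L ^ k - 1) / L ^ i)) ≤
      Real.exp δ * ((p + 1).factorial / δ ^ (p + 1)) / (L - 1) := by
  have hL0 : 0 < L := zero_lt_one.trans hL
  have hfacδ : 0 ≤ ((p + 1).factorial : ℝ) / δ ^ (p + 1) := by positivity
  -- termwise bound: `(L^{k-i})^p e^{-δ(L^k-1)/L^i} ≤ e^δ (p+1)!/δ^{p+1} · (L^{k-i})⁻¹`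
  have hterm : ∀ i ∈ range k, (L ^ (k - i)) ^ p * Real.exp (-(δ * (L ^ k - 1) / L ^ i)) ≤
      Real.exp δ * ((p + 1).factorial / δ ^ (p + 1)) * (L ^ (k - i))⁻¹ := by
    intro i hi
    have hik : i < k := mem_range.1 hi
    have hLi : 0 < L ^ i := pow_pos hL0 i
    have hX : 0 < L ^ (k - i) := pow_pos hL0 _
    -- `(L^k - 1)/L^i = L^{k-i} - L^{-i} ≥ L^{k-i} - 1`
    have hexp : Real.exp (-(δ * (L ^ k - 1) / L ^ i)) ≤ Real.exp δ * Real.exp (-(δ * L ^ (k - i))) := by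
      rw [← Real.exp_add, Real.exp_le_exp]
      have e1 : L ^ k = L ^ (k - i) * L ^ i := by rw [← pow_add, Nat.sub_add_cancel hik.le]
      rw [e1, show -(δ * (L ^ (k - i) * L ^ i - 1) / L ^ i) = -(δ * L ^ (k - i)) + δ / L ^ i by field_simp; ring]
      have : δ / L ^ i ≤ δ := div_le_self hδ.le (one_le_pow₀ hL.le)
      linarith
    have hmain := pow_mul_exp_neg_le hX hδ p
    calc (L ^ (k - i)) ^ p * Real.exp (-(δ * (L ^ k - 1) / L ^ i))
        ≤ (L ^ (k - i)) ^ p * (Real.exp δ * Real.exp (-(δ * L ^ (k - i)))) :=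
          mul_le_mul_of_nonneg_left hexp (pow_nonneg hX.le _)
      _ = Real.exp δ * ((L ^ (k - i)) ^ p * Real.exp (-(δ * L ^ (k - i)))) := by ring
      _ ≤ Real.exp δ * ((p + 1).factorial / (δ ^ (p + 1) * L ^ (k - i))) :=
          mul_le_mul_of_nonneg_left hmain (Real.exp_pos _).le
      _ = Real.exp δ * ((p + 1).factorial / δ ^ (p + 1)) * (L ^ (k - i))⁻¹ := by
          field_simp
  refine (sum_le_sum hterm).trans ?_
  rw [← mul_sum]
  -- geometric tail: `Σ_{i<k} (L^{k-i})⁻¹ = Σ_{j=1}^{k} L^{-j} ≤ 1/(L-1)`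
  have hgeom : ∑ i ∈ range k, (L ^ (k - i))⁻¹ ≤ 1 / (L - 1) := by
    have hr : ∑ i ∈ range k, (L ^ (k - i))⁻¹ = ∑ j ∈ range k, (L⁻¹) ^ (j + 1) := by
      rw [← sum_range_reflect]
      refine sum_congr rfl fun j hj => ?_
      have hjk : j < k := mem_range.1 hj
      rw [inv_pow, show k - (k - 1 - j) = j + 1 by omega]
    rw [hr]
    have hq0 : 0 ≤ L⁻¹ := inv_nonneg.2 hL0.le
    have hq1 : L⁻¹ < 1 := inv_lt_one_of_one_lt₀ hL
    have hs : ∑ j ∈ range k, (L⁻¹) ^ (j + 1) = L⁻¹ * ∑ j ∈ range k, (L⁻¹) ^ j := by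
      rw [mul_sum]; exact sum_congr rfl fun j _ => by ring
    rw [hs]
    have hg : ∑ j ∈ range k, (L⁻¹) ^ j ≤ (L⁻¹) ^ 0 / (1 - L⁻¹) := by
      have := geom_sum_Ico_le_of_lt_one hq0 hq1 (m := 0) (n := k)
      rwa [range_eq_Ico]
    rw [pow_zero] at hg
    have hL1 : 0 < L - 1 := sub_pos.2 hL
    calc L⁻¹ * ∑ j ∈ range k, (L⁻¹) ^ j ≤ L⁻¹ * (1 / (1 - L⁻¹)) := mul_le_mul_of_nonneg_left hg hq0
      _ = 1 / (L - 1) := by field_simp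
  calc Real.exp δ * ((p + 1).factorial / δ ^ (p + 1)) * ∑ i ∈ range k, (L ^ (k - i))⁻¹
      ≤ Real.exp δ * ((p + 1).factorial / δ ^ (p + 1)) * (1 / (L - 1)) :=
        mul_le_mul_of_nonneg_left hgeom (mul_nonneg (Real.exp_pos _).le hfacδ)
    _ = Real.exp δ * ((p + 1).factorial / δ ^ (p + 1)) / (L - 1) := by ring

/-- kernel: `x^{2−d} = x²/x^d`. [folklore] -/
private theorem rpow_two_sub_natCast {x : ℝ} (hx : 0 < x) (d : ℕ) : x ^ ((2 : ℝ) - (d : ℝ)) = x ^ 2 / x ^ d := by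
  rw [Real.rpow_sub hx, Real.rpow_two, Real.rpow_natCast]

/-- kernel: `x^{1−d} = x/x^d`. [folklore] -/
private theorem rpow_one_sub_natCast {x : ℝ} (hx : 0 < x) (d : ℕ) : x ^ ((1 : ℝ) - (d : ℝ)) = x / x ^ d := by
  rw [Real.rpow_sub hx, Real.rpow_one, Real.rpow_natCast]

/-- kernel: the column `x` of the flat block propagator is `ε^d` times the sum of the (2.10) pieces. [cite: Balaban1983Higgs3, (2.6) p.424] -/
theorem towerG_eq_sum_gpiece {a : ℝ} (ha : 0 < a) {k : ℕ} (hk : 1 ≤ k) (z x : Balaban1983to89.Site P 0) :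
    (tower P a 0).G k z x = P.eps ^ P.d * ∑ i ∈ range k, B3Sect3KernelsZeroTorus.gpiece P a 0 k i z x := by
  have h := B3Eq317ZeroTorus.sum_gpiece_eq_G (P := P) ha le_rfl hk z x
  rw [B3Eq317ZeroTorus.sum_gpiece_apply] at h
  have hε : P.eps ^ P.d ≠ 0 := pow_ne_zero _ P.eps_pos.ne'
  rw [h, ← mul_assoc, mul_inv_cancel₀ hε, one_mul]

/-- kernel: the exponent bookkeeping `δ·sp_i⁻¹·(ε·T) = δT/L^i` and the monotonicity in the distance. [folklore] -/
private theorem exp_piece_le {δ : ℝ} (hδ : 0 < δ) (i : ℕ) {T D : ℝ} (hTD : D ≤ T) :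
    Real.exp (-(δ * (P.spacing i)⁻¹ * (P.eps * T))) ≤ Real.exp (-(δ * D / (P.L : ℝ) ^ i)) := by
  have hLi : 0 < (P.L : ℝ) ^ i := pow_pos P.cast_L_pos i
  have hε : 0 < P.eps := P.eps_pos
  have hsp : δ * (P.spacing i)⁻¹ * (P.eps * T) = δ * T / (P.L : ℝ) ^ i := by
    unfold Params.spacing; field_simp
  rw [hsp, Real.exp_le_exp, neg_le_neg_iff]
  exact div_le_div_of_nonneg_right (mul_le_mul_of_nonneg_left hTD hδ.le) hLi.le

/-- **THE FLAT BLOCK PROPAGATOR FAR FROM THE DIAGONAL IS `O((L^kε)²L^{−kd})`**: there is `C_A > 0` (from `d, L, a`) with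
`|G_k(T_ε,0)(z,x)| ≤ C_A(L^kε)²L^{−kd}` whenever `|x − z|_∞ ≥ L^k − 1` (every volume, every `1 ≤ k ≤ K`) — the pointwise
multiscale bounds `|G^η_{(i)}(z,x)| ≤ C(L^iε)^{2−d}e^{−δ|z−x|/L^i}` of [Balaban1983Higgs3] (2.10) summed over the scales with the
super-exponential gain `e^{−δL^{k−i}}`. [cite: Balaban1983Higgs3, (2.10) p.426] -/
theorem annulus_value_bound (d L : ℕ) (hd : 1 ≤ d) (hL : Odd L ∧ 1 < L) {a : ℝ} (ha : 0 < a) :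
    ∃ C_A : ℝ, 0 < C_A ∧ ∀ (P : Params), P.d = d → P.L = L → ∀ k : ℕ, 1 ≤ k → k ≤ P.K →
      ∀ x z : Balaban1983to89.Site P 0, (P.L : ℝ) ^ k ≤ (supDist x z : ℝ) + 1 →
        |(tower P a 0).G k z x| ≤ C_A * (P.spacing k ^ 2 / (P.L : ℝ) ^ (k * P.d)) := by
  obtain ⟨δ, C, hδ, hC, hgp⟩ := B3Sect3KernelsZeroTorus.gpiece_bounds d L hd hL ha (le_refl (0 : ℝ))
  have hL1 : (1 : ℝ) < L := by exact_mod_cast hL.2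
  set S : ℝ := Real.exp δ * (((d + 1).factorial : ℝ) / δ ^ (d + 1)) / ((L : ℝ) - 1) with hS
  have hSpos : 0 < S := by
    have : (0 : ℝ) < L - 1 := sub_pos.2 hL1
    positivity
  refine ⟨C * S, mul_pos hC hSpos, ?_⟩
  intro P hPd hPL k hk1 hkK x z hfar
  obtain ⟨hval, -, -, -⟩ := hgp P hPd hPL k hk1 hkK
  subst hPd; subst hPL
  have hLpos : (0 : ℝ) < P.L := P.cast_L_pos
  have hεpos : 0 < P.eps := P.eps_pos
  have hspk : P.spacing k = (P.L : ℝ) ^ k * P.eps := rfl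
  -- distance bookkeeping
  have hsd : (supDist x z : ℝ) ≤ (Site.tdist z x : ℝ) := by
    rw [B3TorusRadialSums.supDist_comm]; exact_mod_cast B3TorusRadialSums.supDist_le_tdist z x
  have hD : (P.L : ℝ) ^ k - 1 ≤ (Site.tdist z x : ℝ) := by linarith
  -- termwise bound
  have hterm : ∀ i ∈ range k, P.eps ^ P.d * |B3Sect3KernelsZeroTorus.gpiece P a 0 k i z x| ≤
      C * (P.spacing k ^ 2 / (P.L : ℝ) ^ (k * P.d)) *
        (((P.L : ℝ) ^ (k - i)) ^ P.d * Real.exp (-(δ * ((P.L : ℝ) ^ k - 1) / (P.L : ℝ) ^ i))) := by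
    intro i hi
    have hik : i < k := mem_range.1 hi
    have hb := hval i z x
    rw [rpow_two_sub_natCast (P.spacing_pos i)] at hb
    have hexp := exp_piece_le (P := P) hδ i hD
    have hspi : P.spacing i = (P.L : ℝ) ^ i * P.eps := rfl
    have hLi : 0 < (P.L : ℝ) ^ i := pow_pos hLpos i
    have hLki : 0 < (P.L : ℝ) ^ (k - i) := pow_pos hLpos _
    -- the scale identity `ε^d·sp_i²/sp_i^d = (sp_k²/L^{kd})·(L^{k-i})^d/(L^{k-i})²`
    have hid : P.eps ^ P.d * (P.spacing i ^ 2 / P.spacing i ^ P.d) =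
        P.spacing k ^ 2 / (P.L : ℝ) ^ (k * P.d) * (((P.L : ℝ) ^ (k - i)) ^ P.d / ((P.L : ℝ) ^ (k - i)) ^ 2) := by
      have ek : (P.L : ℝ) ^ k = (P.L : ℝ) ^ (k - i) * (P.L : ℝ) ^ i := by rw [← pow_add, Nat.sub_add_cancel hik.le]
      rw [hspi, hspk, pow_mul, ek, mul_pow, mul_pow, mul_pow, mul_pow]
      field_simp
      ring
    have hq : ((P.L : ℝ) ^ (k - i)) ^ P.d / ((P.L : ℝ) ^ (k - i)) ^ 2 ≤ ((P.L : ℝ) ^ (k - i)) ^ P.d :=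
      div_le_self (pow_nonneg hLki.le _) (one_le_pow₀ (one_le_pow₀ hL1.le))
    calc P.eps ^ P.d * |B3Sect3KernelsZeroTorus.gpiece P a 0 k i z x|
        ≤ P.eps ^ P.d * (C * (P.spacing i ^ 2 / P.spacing i ^ P.d) *
            Real.exp (-(δ * (P.spacing i)⁻¹ * (P.eps * (Site.tdist z x : ℝ))))) :=
          mul_le_mul_of_nonneg_left hb (pow_nonneg hεpos.le _)
      _ = C * (P.eps ^ P.d * (P.spacing i ^ 2 / P.spacing i ^ P.d)) *
            Real.exp (-(δ * (P.spacing i)⁻¹ * (P.eps * (Site.tdist z x : ℝ)))) := by ring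
      _ ≤ C * (P.eps ^ P.d * (P.spacing i ^ 2 / P.spacing i ^ P.d)) *
            Real.exp (-(δ * ((P.L : ℝ) ^ k - 1) / (P.L : ℝ) ^ i)) :=
          mul_le_mul_of_nonneg_left hexp (mul_nonneg hC.le (mul_nonneg (pow_nonneg hεpos.le _)
            (div_nonneg (sq_nonneg _) (pow_nonneg (P.spacing_pos i).le _))))
      _ = C * (P.spacing k ^ 2 / (P.L : ℝ) ^ (k * P.d)) *
            ((((P.L : ℝ) ^ (k - i)) ^ P.d / ((P.L : ℝ) ^ (k - i)) ^ 2) *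
              Real.exp (-(δ * ((P.L : ℝ) ^ k - 1) / (P.L : ℝ) ^ i))) := by rw [hid]; ring
      _ ≤ C * (P.spacing k ^ 2 / (P.L : ℝ) ^ (k * P.d)) *
            (((P.L : ℝ) ^ (k - i)) ^ P.d * Real.exp (-(δ * ((P.L : ℝ) ^ k - 1) / (P.L : ℝ) ^ i))) :=
          mul_le_mul_of_nonneg_left (mul_le_mul_of_nonneg_right hq (Real.exp_pos _).le)
            (mul_nonneg hC.le (div_nonneg (sq_nonneg _) (pow_nonneg hLpos.le _)))
  have hsum := scale_sum_le hL1 hδ P.d k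
  calc |(tower P a 0).G k z x|
      = |P.eps ^ P.d * ∑ i ∈ range k, B3Sect3KernelsZeroTorus.gpiece P a 0 k i z x| := by rw [towerG_eq_sum_gpiece ha hk1]
    _ ≤ P.eps ^ P.d * ∑ i ∈ range k, |B3Sect3KernelsZeroTorus.gpiece P a 0 k i z x| := by
        rw [abs_mul, abs_of_pos (pow_pos hεpos _)]
        exact mul_le_mul_of_nonneg_left (abs_sum_le_sum_abs _ _) (pow_nonneg hεpos.le _)
    _ = ∑ i ∈ range k, P.eps ^ P.d * |B3Sect3KernelsZeroTorus.gpiece P a 0 k i z x| := by rw [mul_sum]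
    _ ≤ ∑ i ∈ range k, C * (P.spacing k ^ 2 / (P.L : ℝ) ^ (k * P.d)) *
          (((P.L : ℝ) ^ (k - i)) ^ P.d * Real.exp (-(δ * ((P.L : ℝ) ^ k - 1) / (P.L : ℝ) ^ i))) := sum_le_sum hterm
    _ = C * (P.spacing k ^ 2 / (P.L : ℝ) ^ (k * P.d)) *
          ∑ i ∈ range k, ((P.L : ℝ) ^ (k - i)) ^ P.d * Real.exp (-(δ * ((P.L : ℝ) ^ k - 1) / (P.L : ℝ) ^ i)) := by
        rw [mul_sum]
    _ ≤ C * (P.spacing k ^ 2 / (P.L : ℝ) ^ (k * P.d)) * S :=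
        mul_le_mul_of_nonneg_left hsum (mul_nonneg hC.le (div_nonneg (sq_nonneg _) (pow_nonneg hLpos.le _)))
    _ = C * S * (P.spacing k ^ 2 / (P.L : ℝ) ^ (k * P.d)) := by ring

/-- **THE BOND DIFFERENCES OF THE FLAT BLOCK PROPAGATOR FAR FROM THE DIAGONAL ARE `O((L^kε)²L^{−kd}/L^k)`**: there is `C_B > 0`
(from `d, L, a`) with `|G_k(T_ε,0)(z+e_μ,x) − G_k(T_ε,0)(z,x)| ≤ C_B(L^kε)²L^{−kd}/L^k` whenever `|x − z|_∞ ≥ L^k − 1` — from the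
(2.10) row-difference bounds `|∂^η_μG^η_{(i)}(z,x)| ≤ C(L^iε)^{1−d}e^{−δ|z−x|/L^i}`. [cite: Balaban1983Higgs3, (2.10) p.426] -/
theorem annulus_diff_bound (d L : ℕ) (hd : 1 ≤ d) (hL : Odd L ∧ 1 < L) {a : ℝ} (ha : 0 < a) :
    ∃ C_B : ℝ, 0 < C_B ∧ ∀ (P : Params), P.d = d → P.L = L → ∀ k : ℕ, 1 ≤ k → k ≤ P.K →
      ∀ (x z : Balaban1983to89.Site P 0) (μ : Fin P.d), (P.L : ℝ) ^ k ≤ (supDist x z : ℝ) + 1 →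
        |(tower P a 0).G k (z.shift μ) x - (tower P a 0).G k z x| ≤
          C_B * (P.spacing k ^ 2 / ((P.L : ℝ) ^ (k * P.d) * (P.L : ℝ) ^ k)) := by
  obtain ⟨δ, C, hδ, hC, hgp⟩ := B3Sect3KernelsZeroTorus.gpiece_bounds d L hd hL ha (le_refl (0 : ℝ))
  have hL1 : (1 : ℝ) < L := by exact_mod_cast hL.2
  set S : ℝ := Real.exp δ * (((d + 1).factorial : ℝ) / δ ^ (d + 1)) / ((L : ℝ) - 1) with hS
  have hSpos : 0 < S := by
    have : (0 : ℝ) < L - 1 := sub_pos.2 hL1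
    positivity
  refine ⟨C * S, mul_pos hC hSpos, ?_⟩
  intro P hPd hPL k hk1 hkK x z μ hfar
  obtain ⟨-, hd1, -, -⟩ := hgp P hPd hPL k hk1 hkK
  subst hPd; subst hPL
  have hLpos : (0 : ℝ) < P.L := P.cast_L_pos
  have hεpos : 0 < P.eps := P.eps_pos
  have hspk : P.spacing k = (P.L : ℝ) ^ k * P.eps := rfl
  have hsd : (supDist x z : ℝ) ≤ (Site.tdist z x : ℝ) := by
    rw [B3TorusRadialSums.supDist_comm]; exact_mod_cast B3TorusRadialSums.supDist_le_tdist z x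
  have hD : (P.L : ℝ) ^ k - 1 ≤ (Site.tdist z x : ℝ) := by linarith
  -- the difference of the columns as `ε^d·ε·Σ_i (∂_μ piece_i)`
  have hdiff : (tower P a 0).G k (z.shift μ) x - (tower P a 0).G k z x =
      P.eps ^ P.d * ∑ i ∈ range k, P.eps * B3Sect3ScalarSelfEnergy.d1Kernel (P.eps)⁻¹ μ
        (B3Sect3KernelsZeroTorus.gpiece P a 0 k i) z x := by
    rw [towerG_eq_sum_gpiece ha hk1, towerG_eq_sum_gpiece ha hk1, ← mul_sub, ← sum_sub_distrib]
    congr 1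
    refine sum_congr rfl fun i _ => ?_
    unfold B3Sect3ScalarSelfEnergy.d1Kernel
    rw [← mul_assoc, mul_inv_cancel₀ hεpos.ne', one_mul]
  have hterm : ∀ i ∈ range k, P.eps ^ P.d * |P.eps * B3Sect3ScalarSelfEnergy.d1Kernel (P.eps)⁻¹ μ
      (B3Sect3KernelsZeroTorus.gpiece P a 0 k i) z x| ≤
      C * (P.spacing k ^ 2 / ((P.L : ℝ) ^ (k * P.d) * (P.L : ℝ) ^ k)) *
        (((P.L : ℝ) ^ (k - i)) ^ P.d * Real.exp (-(δ * ((P.L : ℝ) ^ k - 1) / (P.L : ℝ) ^ i))) := by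
    intro i hi
    have hik : i < k := mem_range.1 hi
    have hb := hd1 i μ z x
    rw [rpow_one_sub_natCast (P.spacing_pos i)] at hb
    have hexp := exp_piece_le (P := P) hδ i hD
    have hspi : P.spacing i = (P.L : ℝ) ^ i * P.eps := rfl
    have hLi : 0 < (P.L : ℝ) ^ i := pow_pos hLpos i
    have hLki : 0 < (P.L : ℝ) ^ (k - i) := pow_pos hLpos _
    have hid : P.eps ^ P.d * (P.eps * (P.spacing i / P.spacing i ^ P.d)) =
        P.spacing k ^ 2 / ((P.L : ℝ) ^ (k * P.d) * (P.L : ℝ) ^ k) *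
          (((P.L : ℝ) ^ (k - i)) ^ P.d / (P.L : ℝ) ^ (k - i)) := by
      have ek : (P.L : ℝ) ^ k = (P.L : ℝ) ^ (k - i) * (P.L : ℝ) ^ i := by rw [← pow_add, Nat.sub_add_cancel hik.le]
      rw [hspi, hspk, pow_mul, ek, mul_pow, mul_pow, mul_pow]
      field_simp
      ring
    have hq : ((P.L : ℝ) ^ (k - i)) ^ P.d / (P.L : ℝ) ^ (k - i) ≤ ((P.L : ℝ) ^ (k - i)) ^ P.d :=
      div_le_self (pow_nonneg hLki.le _) (one_le_pow₀ hL1.le)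
    rw [abs_mul, abs_of_pos hεpos]
    calc P.eps ^ P.d * (P.eps * |B3Sect3ScalarSelfEnergy.d1Kernel (P.eps)⁻¹ μ
          (B3Sect3KernelsZeroTorus.gpiece P a 0 k i) z x|)
        ≤ P.eps ^ P.d * (P.eps * (C * (P.spacing i / P.spacing i ^ P.d) *
            Real.exp (-(δ * (P.spacing i)⁻¹ * (P.eps * (Site.tdist z x : ℝ)))))) :=
          mul_le_mul_of_nonneg_left (mul_le_mul_of_nonneg_left hb hεpos.le) (pow_nonneg hεpos.le _)
      _ = C * (P.eps ^ P.d * (P.eps * (P.spacing i / P.spacing i ^ P.d))) *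
            Real.exp (-(δ * (P.spacing i)⁻¹ * (P.eps * (Site.tdist z x : ℝ)))) := by ring
      _ ≤ C * (P.eps ^ P.d * (P.eps * (P.spacing i / P.spacing i ^ P.d))) *
            Real.exp (-(δ * ((P.L : ℝ) ^ k - 1) / (P.L : ℝ) ^ i)) :=
          mul_le_mul_of_nonneg_left hexp (mul_nonneg hC.le (mul_nonneg (pow_nonneg hεpos.le _)
            (mul_nonneg hεpos.le (div_nonneg (P.spacing_pos i).le (pow_nonneg (P.spacing_pos i).le _)))))
      _ = C * (P.spacing k ^ 2 / ((P.L : ℝ) ^ (k * P.d) * (P.L : ℝ) ^ k)) *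
            ((((P.L : ℝ) ^ (k - i)) ^ P.d / (P.L : ℝ) ^ (k - i)) *
              Real.exp (-(δ * ((P.L : ℝ) ^ k - 1) / (P.L : ℝ) ^ i))) := by rw [hid]; ring
      _ ≤ C * (P.spacing k ^ 2 / ((P.L : ℝ) ^ (k * P.d) * (P.L : ℝ) ^ k)) *
            (((P.L : ℝ) ^ (k - i)) ^ P.d * Real.exp (-(δ * ((P.L : ℝ) ^ k - 1) / (P.L : ℝ) ^ i))) :=
          mul_le_mul_of_nonneg_left (mul_le_mul_of_nonneg_right hq (Real.exp_pos _).le)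
            (mul_nonneg hC.le (div_nonneg (sq_nonneg _) (mul_nonneg (pow_nonneg hLpos.le _) (pow_nonneg hLpos.le _))))
  have hsum := scale_sum_le hL1 hδ P.d k
  have hK0 : 0 ≤ C * (P.spacing k ^ 2 / ((P.L : ℝ) ^ (k * P.d) * (P.L : ℝ) ^ k)) :=
    mul_nonneg hC.le (div_nonneg (sq_nonneg _) (mul_nonneg (pow_nonneg hLpos.le _) (pow_nonneg hLpos.le _)))
  rw [hdiff, abs_mul, abs_of_pos (pow_pos hεpos _)]
  calc P.eps ^ P.d * |∑ i ∈ range k, P.eps * B3Sect3ScalarSelfEnergy.d1Kernel (P.eps)⁻¹ μ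
          (B3Sect3KernelsZeroTorus.gpiece P a 0 k i) z x|
      ≤ P.eps ^ P.d * ∑ i ∈ range k, |P.eps * B3Sect3ScalarSelfEnergy.d1Kernel (P.eps)⁻¹ μ
          (B3Sect3KernelsZeroTorus.gpiece P a 0 k i) z x| :=
        mul_le_mul_of_nonneg_left (abs_sum_le_sum_abs _ _) (pow_nonneg hεpos.le _)
    _ = ∑ i ∈ range k, P.eps ^ P.d * |P.eps * B3Sect3ScalarSelfEnergy.d1Kernel (P.eps)⁻¹ μ
          (B3Sect3KernelsZeroTorus.gpiece P a 0 k i) z x| := by rw [mul_sum]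
    _ ≤ ∑ i ∈ range k, C * (P.spacing k ^ 2 / ((P.L : ℝ) ^ (k * P.d) * (P.L : ℝ) ^ k)) *
          (((P.L : ℝ) ^ (k - i)) ^ P.d * Real.exp (-(δ * ((P.L : ℝ) ^ k - 1) / (P.L : ℝ) ^ i))) := sum_le_sum hterm
    _ = C * (P.spacing k ^ 2 / ((P.L : ℝ) ^ (k * P.d) * (P.L : ℝ) ^ k)) *
          ∑ i ∈ range k, ((P.L : ℝ) ^ (k - i)) ^ P.d * Real.exp (-(δ * ((P.L : ℝ) ^ k - 1) / (P.L : ℝ) ^ i)) := by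
        rw [mul_sum]
    _ ≤ C * (P.spacing k ^ 2 / ((P.L : ℝ) ^ (k * P.d) * (P.L : ℝ) ^ k)) * S := mul_le_mul_of_nonneg_left hsum hK0
    _ = C * S * (P.spacing k ^ 2 / ((P.L : ℝ) ^ (k * P.d) * (P.L : ℝ) ^ k)) := by ring

/-! ## §2. The weighted energy inequality for `f + n²Λ_Bf = g + n²div_BF`

Stated at EQUATION level over an arbitrary bond set `B` (p34's `lapN Ω` is the case `B = Ω*`, `lapN_mulVec_eq_sum`), with the
divergence written against p34's bond vectors `v_b`. -/

/-- **SUMMATION BY PARTS** against p34's bond vectors: `Σ_y h(y)·Σ_{b∈B} X_b v_b(y) = Σ_{b∈B}(h(b₊) − h(b₋))X_b`.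
[cite: Balaban1983RegularityDecay, (1.3) p.572] -/
theorem sum_mul_sum_bvec (B : Finset (PBond P 0)) (h : Balaban1983to89.Site P 0 → ℝ) (X : PBond P 0 → ℝ) :
    ∑ y, h y * ∑ b ∈ B, X b * bvec b y = ∑ b ∈ B, (h b.tgt - h b.src) * X b := by
  calc ∑ y, h y * ∑ b ∈ B, X b * bvec b y = ∑ y, ∑ b ∈ B, h y * (X b * bvec b y) := by
        simp_rw [mul_sum]
    _ = ∑ b ∈ B, ∑ y, h y * (X b * bvec b y) := sum_comm
    _ = ∑ b ∈ B, (h b.tgt - h b.src) * X b := sum_congr rfl fun b _ => by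
        calc ∑ y, h y * (X b * bvec b y) = X b * ∑ y, bvec b y * h y := by
              rw [mul_sum]; exact sum_congr rfl fun y _ => by ring
          _ = (h b.tgt - h b.src) * X b := by rw [sum_bvec_mul]; ring

/-- kernel: a sub-sum over bonds of a nonnegative site function at the initial points is at most `d` times the site sum (`d` bonds of the
lattice (1.3) start at each site). [cite: Balaban1983RegularityDecay, (1.3) p.572] -/
theorem sum_src_le (B : Finset (PBond P 0)) {φ : Balaban1983to89.Site P 0 → ℝ} (hφ : ∀ y, 0 ≤ φ y) :
    ∑ b ∈ B, φ b.src ≤ P.d * ∑ y, φ y := by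
  calc ∑ b ∈ B, φ b.src ≤ ∑ b : PBond P 0, φ b.src := sum_le_univ_sum_of_nonneg fun b => hφ _
    _ = ∑ p : Balaban1983to89.Site P 0 × Fin P.d, φ p.1 :=
        Fintype.sum_equiv (⟨fun b => (b.src, b.dir), fun p => ⟨p.1, p.2⟩, fun _ => rfl, fun _ => rfl⟩ :
      PBond P 0 ≃ Balaban1983to89.Site P 0 × Fin P.d)
          (fun b => φ b.src) (fun p => φ p.1) fun _ => rfl
    _ = P.d * ∑ y, φ y := by
        rw [Fintype.sum_prod_type]
        simp only [sum_const, card_univ, Fintype.card_fin, nsmul_eq_mul]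
        rw [mul_sum]

/-- kernel: the same at the final points (the shift is a bijection of the torus). [cite: Balaban1983RegularityDecay, (1.3) p.572] -/
theorem sum_tgt_le (B : Finset (PBond P 0)) {φ : Balaban1983to89.Site P 0 → ℝ} (hφ : ∀ y, 0 ≤ φ y) :
    ∑ b ∈ B, φ b.tgt ≤ P.d * ∑ y, φ y := by
  calc ∑ b ∈ B, φ b.tgt ≤ ∑ b : PBond P 0, φ b.tgt := sum_le_univ_sum_of_nonneg fun b => hφ _
    _ = ∑ p : Balaban1983to89.Site P 0 × Fin P.d, φ (p.1.shift p.2) :=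
        Fintype.sum_equiv (⟨fun b => (b.src, b.dir), fun p => ⟨p.1, p.2⟩, fun _ => rfl, fun _ => rfl⟩ :
      PBond P 0 ≃ Balaban1983to89.Site P 0 × Fin P.d)
          (fun b => φ b.tgt) (fun p => φ (p.1.shift p.2)) fun _ => rfl
    _ = ∑ μ : Fin P.d, ∑ y : Balaban1983to89.Site P 0, φ (y.shift μ) := by rw [Fintype.sum_prod_type_right]
    _ = ∑ μ : Fin P.d, ∑ y : Balaban1983to89.Site P 0, φ y :=
        sum_congr rfl fun μ _ => Fintype.sum_equiv (LatticeFieldCalculus.shiftEquiv μ) _ _ fun _ => rfl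
    _ = P.d * ∑ y, φ y := by simp

/-- kernel (the per-bond algebra of the energy term): with `P = (w₋² + w₊²)/2 > 0`, `(w₊ − w₋)² ≤ κw₋w₊` and the ratio bounds,
`½P(f₋−f₊)² − ½κ(1+ρ)(w₋²f₋² + w₊²f₊²) ≤ (w₋²f₋ − w₊²f₊)(f₋ − f₊)`. [folklore] -/
private theorem bond_energy_lower {ws wt fs ft κ ρ : ℝ} (hws : 0 < ws) (hwt : 0 < wt) (hκ : 0 ≤ κ)
    (ho : (wt - ws) ^ 2 ≤ κ * (ws * wt)) (hr1 : ws ^ 2 ≤ ρ * wt ^ 2) (hr2 : wt ^ 2 ≤ ρ * ws ^ 2) :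
    (ws ^ 2 + wt ^ 2) / 2 * (fs - ft) ^ 2 / 2 - κ * (1 + ρ) / 2 * (ws ^ 2 * fs ^ 2 + wt ^ 2 * ft ^ 2) ≤
      (ws ^ 2 * fs - wt ^ 2 * ft) * (fs - ft) := by
  set Pw : ℝ := (ws ^ 2 + wt ^ 2) / 2 with hPw
  have hP : 0 < Pw := by positivity
  -- `(ws² − wt²)² ≤ κ(ws²+wt²)² = 4κPw²`
  have hsq : (ws ^ 2 - wt ^ 2) ^ 2 ≤ κ * (ws ^ 2 + wt ^ 2) ^ 2 := by
    have e : (ws ^ 2 - wt ^ 2) ^ 2 = (wt - ws) ^ 2 * (ws + wt) ^ 2 := by ring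
    have h1 : (wt - ws) ^ 2 * (ws + wt) ^ 2 ≤ κ * (ws * wt) * (ws + wt) ^ 2 :=
      mul_le_mul_of_nonneg_right ho (sq_nonneg _)
    have h2 : 0 ≤ (ws ^ 2 + wt ^ 2) ^ 2 - ws * wt * (ws + wt) ^ 2 := by
      have e2 : (ws ^ 2 + wt ^ 2) ^ 2 - ws * wt * (ws + wt) ^ 2 = (ws - wt) ^ 2 * (ws ^ 2 + ws * wt + wt ^ 2) := by ring
      rw [e2]; exact mul_nonneg (sq_nonneg _) (by positivity)
    have h3 : κ * (ws * wt) * (ws + wt) ^ 2 ≤ κ * (ws ^ 2 + wt ^ 2) ^ 2 := by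
      have := mul_le_mul_of_nonneg_left (sub_nonneg.1 h2) hκ
      linarith
    rw [e]; exact h1.trans h3
  -- `Pw·σ² ≤ (1+ρ)(ws²fs² + wt²ft²)`
  have hσ : Pw * (fs + ft) ^ 2 ≤ (1 + ρ) * (ws ^ 2 * fs ^ 2 + wt ^ 2 * ft ^ 2) := by
    have h1 : (fs + ft) ^ 2 ≤ 2 * (fs ^ 2 + ft ^ 2) := by nlinarith [sq_nonneg (fs - ft)]
    have h2 : Pw * (fs + ft) ^ 2 ≤ (ws ^ 2 + wt ^ 2) * (fs ^ 2 + ft ^ 2) := by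
      have := mul_le_mul_of_nonneg_left h1 hP.le
      have e : Pw * (2 * (fs ^ 2 + ft ^ 2)) = (ws ^ 2 + wt ^ 2) * (fs ^ 2 + ft ^ 2) := by rw [hPw]; ring
      linarith
    have h3 : ws ^ 2 * ft ^ 2 ≤ ρ * wt ^ 2 * ft ^ 2 := mul_le_mul_of_nonneg_right hr1 (sq_nonneg ft)
    have h4 : wt ^ 2 * fs ^ 2 ≤ ρ * ws ^ 2 * fs ^ 2 := mul_le_mul_of_nonneg_right hr2 (sq_nonneg fs)
    have e5 : (ws ^ 2 + wt ^ 2) * (fs ^ 2 + ft ^ 2) = ws ^ 2 * fs ^ 2 + wt ^ 2 * ft ^ 2 + (ws ^ 2 * ft ^ 2 + wt ^ 2 * fs ^ 2) := by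
      ring
    have e6 : (1 + ρ) * (ws ^ 2 * fs ^ 2 + wt ^ 2 * ft ^ 2) =
        ws ^ 2 * fs ^ 2 + wt ^ 2 * ft ^ 2 + (ρ * ws ^ 2 * fs ^ 2 + ρ * wt ^ 2 * ft ^ 2) := by ring
    linarith
  -- the cross term by AM–GM: with `y = ½(ws²−wt²)σ`, `yδ ≥ −(Pwδ²/2 + y²/(2Pw))` and `y² ≤ κPw²σ²`
  set δ : ℝ := fs - ft with hδ
  set σ : ℝ := fs + ft with hσdef
  set y : ℝ := (ws ^ 2 - wt ^ 2) / 2 * σ with hy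
  have hy2 : y ^ 2 ≤ κ * Pw ^ 2 * σ ^ 2 := by
    have e : y ^ 2 = (ws ^ 2 - wt ^ 2) ^ 2 * σ ^ 2 / 4 := by rw [hy]; ring
    have e' : κ * Pw ^ 2 * σ ^ 2 = κ * (ws ^ 2 + wt ^ 2) ^ 2 * σ ^ 2 / 4 := by rw [hPw]; ring
    rw [e, e']
    have := mul_le_mul_of_nonneg_right hsq (sq_nonneg σ)
    linarith
  have hcross : -(Pw * δ ^ 2 / 2 + κ * Pw * σ ^ 2 / 2) ≤ y * δ := by
    have h1 : 0 ≤ (Pw * δ + y) ^ 2 := sq_nonneg _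
    have h2 : -(Pw ^ 2 * δ ^ 2 + y ^ 2) ≤ 2 * Pw * (y * δ) := by nlinarith [h1]
    have h3 : -(Pw ^ 2 * δ ^ 2 + κ * Pw ^ 2 * σ ^ 2) ≤ 2 * Pw * (y * δ) := by linarith
    have h4 : -(Pw * δ ^ 2 / 2 + κ * Pw * σ ^ 2 / 2) * (2 * Pw) ≤ (y * δ) * (2 * Pw) := by
      have e : -(Pw * δ ^ 2 / 2 + κ * Pw * σ ^ 2 / 2) * (2 * Pw) = -(Pw ^ 2 * δ ^ 2 + κ * Pw ^ 2 * σ ^ 2) := by ring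
      rw [e]; linarith
    exact le_of_mul_le_mul_right h4 (by positivity)
  have hκσ : κ * Pw * σ ^ 2 / 2 ≤ κ * (1 + ρ) / 2 * (ws ^ 2 * fs ^ 2 + wt ^ 2 * ft ^ 2) := by
    have := mul_le_mul_of_nonneg_left hσ (by positivity : (0 : ℝ) ≤ κ / 2)
    have e1 : κ * Pw * σ ^ 2 / 2 = κ / 2 * (Pw * (fs + ft) ^ 2) := by rw [hσdef]; ring
    have e2 : κ * (1 + ρ) / 2 * (ws ^ 2 * fs ^ 2 + wt ^ 2 * ft ^ 2) = κ / 2 * ((1 + ρ) * (ws ^ 2 * fs ^ 2 + wt ^ 2 * ft ^ 2)) := by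
      ring
    rw [e1, e2]; exact this
  have eI : (ws ^ 2 * fs - wt ^ 2 * ft) * (fs - ft) = Pw * δ ^ 2 + y * δ := by rw [hPw, hy, hδ, hσdef]; ring
  rw [eI]
  have eL : (ws ^ 2 + wt ^ 2) / 2 * (fs - ft) ^ 2 / 2 = Pw * δ ^ 2 / 2 := by rw [hPw, hδ]
  rw [eL]
  linarith [hcross, hκσ]

/-- kernel (the per-bond algebra of the divergence source): `(w₋²f₋ − w₊²f₊)F ≤ P(f₋−f₊)²/8 + (5/2)PF² + ½κ(1+ρ)(w₋²f₋²+w₊²f₊²)`.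
[folklore] -/
private theorem bond_div_upper {ws wt fs ft κ ρ F : ℝ} (hws : 0 < ws) (hwt : 0 < wt) (hκ : 0 ≤ κ)
    (ho : (wt - ws) ^ 2 ≤ κ * (ws * wt)) (hr1 : ws ^ 2 ≤ ρ * wt ^ 2) (hr2 : wt ^ 2 ≤ ρ * ws ^ 2) :
    (ws ^ 2 * fs - wt ^ 2 * ft) * F ≤
      (ws ^ 2 + wt ^ 2) / 2 * (fs - ft) ^ 2 / 8 + 5 / 2 * ((ws ^ 2 + wt ^ 2) / 2 * F ^ 2) +
        κ * (1 + ρ) / 2 * (ws ^ 2 * fs ^ 2 + wt ^ 2 * ft ^ 2) := by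
  set Pw : ℝ := (ws ^ 2 + wt ^ 2) / 2 with hPw
  have hP : 0 < Pw := by positivity
  have hsq : (ws ^ 2 - wt ^ 2) ^ 2 ≤ κ * (ws ^ 2 + wt ^ 2) ^ 2 := by
    have e : (ws ^ 2 - wt ^ 2) ^ 2 = (wt - ws) ^ 2 * (ws + wt) ^ 2 := by ring
    have h1 : (wt - ws) ^ 2 * (ws + wt) ^ 2 ≤ κ * (ws * wt) * (ws + wt) ^ 2 :=
      mul_le_mul_of_nonneg_right ho (sq_nonneg _)
    have h2 : 0 ≤ (ws ^ 2 + wt ^ 2) ^ 2 - ws * wt * (ws + wt) ^ 2 := by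
      have e2 : (ws ^ 2 + wt ^ 2) ^ 2 - ws * wt * (ws + wt) ^ 2 = (ws - wt) ^ 2 * (ws ^ 2 + ws * wt + wt ^ 2) := by ring
      rw [e2]; exact mul_nonneg (sq_nonneg _) (by positivity)
    have h3 : κ * (ws * wt) * (ws + wt) ^ 2 ≤ κ * (ws ^ 2 + wt ^ 2) ^ 2 := by
      have := mul_le_mul_of_nonneg_left (sub_nonneg.1 h2) hκ
      linarith
    rw [e]; exact h1.trans h3
  have hσ : Pw * (fs + ft) ^ 2 ≤ (1 + ρ) * (ws ^ 2 * fs ^ 2 + wt ^ 2 * ft ^ 2) := by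
    have h1 : (fs + ft) ^ 2 ≤ 2 * (fs ^ 2 + ft ^ 2) := by nlinarith [sq_nonneg (fs - ft)]
    have h2 : Pw * (fs + ft) ^ 2 ≤ (ws ^ 2 + wt ^ 2) * (fs ^ 2 + ft ^ 2) := by
      have := mul_le_mul_of_nonneg_left h1 hP.le
      have e : Pw * (2 * (fs ^ 2 + ft ^ 2)) = (ws ^ 2 + wt ^ 2) * (fs ^ 2 + ft ^ 2) := by rw [hPw]; ring
      linarith
    have h3 : ws ^ 2 * ft ^ 2 ≤ ρ * wt ^ 2 * ft ^ 2 := mul_le_mul_of_nonneg_right hr1 (sq_nonneg ft)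
    have h4 : wt ^ 2 * fs ^ 2 ≤ ρ * ws ^ 2 * fs ^ 2 := mul_le_mul_of_nonneg_right hr2 (sq_nonneg fs)
    have e5 : (ws ^ 2 + wt ^ 2) * (fs ^ 2 + ft ^ 2) = ws ^ 2 * fs ^ 2 + wt ^ 2 * ft ^ 2 + (ws ^ 2 * ft ^ 2 + wt ^ 2 * fs ^ 2) := by
      ring
    have e6 : (1 + ρ) * (ws ^ 2 * fs ^ 2 + wt ^ 2 * ft ^ 2) =
        ws ^ 2 * fs ^ 2 + wt ^ 2 * ft ^ 2 + (ρ * ws ^ 2 * fs ^ 2 + ρ * wt ^ 2 * ft ^ 2) := by ring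
    linarith
  set δ : ℝ := fs - ft with hδ
  set σ : ℝ := fs + ft with hσdef
  set y : ℝ := (ws ^ 2 - wt ^ 2) / 2 * σ with hy
  have hy2 : y ^ 2 ≤ κ * Pw ^ 2 * σ ^ 2 := by
    have e : y ^ 2 = (ws ^ 2 - wt ^ 2) ^ 2 * σ ^ 2 / 4 := by rw [hy]; ring
    have e' : κ * Pw ^ 2 * σ ^ 2 = κ * (ws ^ 2 + wt ^ 2) ^ 2 * σ ^ 2 / 4 := by rw [hPw]; ring
    rw [e, e']
    have := mul_le_mul_of_nonneg_right hsq (sq_nonneg σ)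
    linarith
  -- `Pw δ F ≤ Pw(δ²/8 + 2F²)` and `yF ≤ y²/(2Pw) + PwF²/2 ≤ κPwσ²/2 + PwF²/2`
  have h1 : Pw * δ * F ≤ Pw * (δ ^ 2 / 8 + 2 * F ^ 2) := by
    have : δ * F ≤ δ ^ 2 / 8 + 2 * F ^ 2 := by nlinarith [sq_nonneg (δ - 4 * F)]
    have := mul_le_mul_of_nonneg_left this hP.le
    linarith
  have h2 : y * F ≤ κ * Pw * σ ^ 2 / 2 + Pw * F ^ 2 / 2 := by
    have h0 : 0 ≤ (y - Pw * F) ^ 2 := sq_nonneg _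
    have h3 : 2 * Pw * (y * F) ≤ y ^ 2 + Pw ^ 2 * F ^ 2 := by nlinarith [h0]
    have h4 : 2 * Pw * (y * F) ≤ κ * Pw ^ 2 * σ ^ 2 + Pw ^ 2 * F ^ 2 := by linarith
    have h5 : (y * F) * (2 * Pw) ≤ (κ * Pw * σ ^ 2 / 2 + Pw * F ^ 2 / 2) * (2 * Pw) := by
      have e : (κ * Pw * σ ^ 2 / 2 + Pw * F ^ 2 / 2) * (2 * Pw) = κ * Pw ^ 2 * σ ^ 2 + Pw ^ 2 * F ^ 2 := by ring
      rw [e]; linarith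
    exact le_of_mul_le_mul_right h5 (by positivity)
  have hκσ : κ * Pw * σ ^ 2 / 2 ≤ κ * (1 + ρ) / 2 * (ws ^ 2 * fs ^ 2 + wt ^ 2 * ft ^ 2) := by
    have := mul_le_mul_of_nonneg_left hσ (by positivity : (0 : ℝ) ≤ κ / 2)
    have e1 : κ * Pw * σ ^ 2 / 2 = κ / 2 * (Pw * (fs + ft) ^ 2) := by rw [hσdef]; ring
    have e2 : κ * (1 + ρ) / 2 * (ws ^ 2 * fs ^ 2 + wt ^ 2 * ft ^ 2) = κ / 2 * ((1 + ρ) * (ws ^ 2 * fs ^ 2 + wt ^ 2 * ft ^ 2)) := by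
      ring
    rw [e1, e2]; exact this
  have eI : (ws ^ 2 * fs - wt ^ 2 * ft) * F = Pw * δ * F + y * F := by rw [hPw, hy, hδ, hσdef]; ring
  have eL : (ws ^ 2 + wt ^ 2) / 2 * (fs - ft) ^ 2 / 8 + 5 / 2 * ((ws ^ 2 + wt ^ 2) / 2 * F ^ 2) =
      Pw * δ ^ 2 / 8 + 5 / 2 * (Pw * F ^ 2) := by rw [hPw, hδ]
  rw [eI, eL]
  nlinarith [h1, h2, hκσ]

/-- **THE WEIGHTED ENERGY INEQUALITY** for `f + n²Λ_Bf = g + n²div_BF`: for a positive weight `w` with squared bond oscillation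
`≤ κ·w(b₋)w(b₊)` and squared ratio `≤ ρ` across the bonds of `B`, and `8n²κd(1+ρ) ≤ 1`:
`Σ_y(w f)² ≤ 2Σ_y(w g)² + 5n²Σ_{b∈B}½(w(b₋)² + w(b₊)²)F_b²` (test the equation against `w²f`; the divergence source costs one
power of `n`) — the one estimate of our torus-comparison proof of the deep-row form of (1.10) (an Agmon-type weighted energy bound;
DIVERGENCE OF METHOD from [6]'s random-walk expansion disclosed). [cite: Balaban1983RegularityDecay, (1.10) p.573] -/
theorem energy_weighted (B : Finset (PBond P 0)) {n κ ρ : ℝ} {w f g : Balaban1983to89.Site P 0 → ℝ} {F : PBond P 0 → ℝ}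
    (hw : ∀ y, 0 < w y) (hκ : 0 ≤ κ) (hρ : 0 ≤ ρ)
    (hosc : ∀ b ∈ B, (w b.tgt - w b.src) ^ 2 ≤ κ * (w b.src * w b.tgt))
    (hrat : ∀ b ∈ B, w b.src ^ 2 ≤ ρ * w b.tgt ^ 2 ∧ w b.tgt ^ 2 ≤ ρ * w b.src ^ 2)
    (hsmall : 8 * n ^ 2 * κ * P.d * (1 + ρ) ≤ 1)
    (heq : ∀ y, f y + n ^ 2 * ∑ b ∈ B, (f b.tgt - f b.src) * bvec b y = g y + n ^ 2 * ∑ b ∈ B, F b * bvec b y) :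
    ∑ y, (w y * f y) ^ 2 ≤ 2 * ∑ y, (w y * g y) ^ 2 + 5 * n ^ 2 * ∑ b ∈ B, (w b.src ^ 2 + w b.tgt ^ 2) / 2 * F b ^ 2 := by
  -- notation
  set A : ℝ := ∑ y, (w y * f y) ^ 2 with hA
  set G : ℝ := ∑ y, (w y * g y) ^ 2 with hG
  set Φ : ℝ := ∑ b ∈ B, (w b.src ^ 2 + w b.tgt ^ 2) / 2 * F b ^ 2 with hΦ
  set E : ℝ := ∑ b ∈ B, (w b.src ^ 2 + w b.tgt ^ 2) / 2 * (f b.src - f b.tgt) ^ 2 with hE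
  set S : ℝ := ∑ b ∈ B, (w b.src ^ 2 * f b.src ^ 2 + w b.tgt ^ 2 * f b.tgt ^ 2) with hS
  set I : ℝ := ∑ b ∈ B, (w b.src ^ 2 * f b.src - w b.tgt ^ 2 * f b.tgt) * (f b.src - f b.tgt) with hI
  set R₁ : ℝ := ∑ y, w y ^ 2 * f y * g y with hR₁
  set R₂ : ℝ := ∑ b ∈ B, (w b.tgt ^ 2 * f b.tgt - w b.src ^ 2 * f b.src) * F b with hR₂
  have hE0 : 0 ≤ E := sum_nonneg fun b _ => by positivity
  have hΦ0 : 0 ≤ Φ := sum_nonneg fun b _ => by positivity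
  have hA0 : 0 ≤ A := sum_nonneg fun y _ => sq_nonneg _
  have hn2 : 0 ≤ n ^ 2 := sq_nonneg _
  -- `S ≤ 2d·A`
  have hS_le : S ≤ 2 * P.d * A := by
    have h1 := sum_src_le B (φ := fun y => w y ^ 2 * f y ^ 2) (fun y => by positivity)
    have h2 := sum_tgt_le B (φ := fun y => w y ^ 2 * f y ^ 2) (fun y => by positivity)
    have e : A = ∑ y, w y ^ 2 * f y ^ 2 := sum_congr rfl fun y _ => by ring
    rw [hS, sum_add_distrib, e]; linarith
  -- test the equation against `w²f`: `A + n²I = R₁ + n²R₂`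
  have htest : A + n ^ 2 * I = R₁ + n ^ 2 * R₂ := by
    have h := fun y => congr_arg (fun r => w y ^ 2 * f y * r) (heq y)
    have hsum := Finset.sum_congr rfl fun y (_ : y ∈ (univ : Finset _)) => h y
    simp only [mul_add] at hsum
    rw [sum_add_distrib, sum_add_distrib] at hsum
    have e1 : ∑ y, w y ^ 2 * f y * (n ^ 2 * ∑ b ∈ B, (f b.tgt - f b.src) * bvec b y) = n ^ 2 * I := by
      calc ∑ y, w y ^ 2 * f y * (n ^ 2 * ∑ b ∈ B, (f b.tgt - f b.src) * bvec b y)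
          = n ^ 2 * ∑ y, (w y ^ 2 * f y) * ∑ b ∈ B, (f b.tgt - f b.src) * bvec b y := by
            rw [mul_sum]; exact sum_congr rfl fun y _ => by ring
        _ = n ^ 2 * I := by
            rw [sum_mul_sum_bvec, hI]
            exact congr_arg _ (sum_congr rfl fun b _ => by ring)
    have e2 : ∑ y, w y ^ 2 * f y * (n ^ 2 * ∑ b ∈ B, F b * bvec b y) = n ^ 2 * R₂ := by
      calc ∑ y, w y ^ 2 * f y * (n ^ 2 * ∑ b ∈ B, F b * bvec b y)
          = n ^ 2 * ∑ y, (w y ^ 2 * f y) * ∑ b ∈ B, F b * bvec b y := by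
            rw [mul_sum]; exact sum_congr rfl fun y _ => by ring
        _ = n ^ 2 * R₂ := by
            rw [sum_mul_sum_bvec, hR₂]
    have e0 : ∑ y, w y ^ 2 * f y * f y = A := sum_congr rfl fun y _ => by ring
    rw [e0, e1, e2] at hsum
    exact hsum
  -- the energy term from below: `I ≥ E/2 − ½κ(1+ρ)S`
  have hI_ge : E / 2 - κ * (1 + ρ) / 2 * S ≤ I := by
    have h := sum_le_sum fun b (hb : b ∈ B) =>
      bond_energy_lower (fs := f b.src) (ft := f b.tgt) (hw b.src) (hw b.tgt) hκ (hosc b hb) (hrat b hb).1 (hrat b hb).2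
    rw [sum_sub_distrib, ← sum_div, ← mul_sum] at h
    rw [hE, hS, hI]
    exact h
  -- the plain source: `R₁ ≤ A/4 + G`
  have hR₁_le : R₁ ≤ A / 4 + G := by
    rw [hR₁, hA, hG, sum_div, ← sum_add_distrib]
    refine sum_le_sum fun y _ => ?_
    nlinarith [sq_nonneg (w y * f y - 2 * (w y * g y))]
  -- the divergence source: `R₂ ≤ E/8 + (5/2)Φ + ½κ(1+ρ)S`
  have hR₂_le : R₂ ≤ E / 8 + 5 / 2 * Φ + κ * (1 + ρ) / 2 * S := by
    have h := sum_le_sum fun b (hb : b ∈ B) => by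
      have h0 := bond_div_upper (fs := f b.src) (ft := f b.tgt) (F := -F b) (hw b.src) (hw b.tgt) hκ (hosc b hb) (hrat b hb).1
        (hrat b hb).2
      have ea : (w b.src ^ 2 * f b.src - w b.tgt ^ 2 * f b.tgt) * -F b = (w b.tgt ^ 2 * f b.tgt - w b.src ^ 2 * f b.src) * F b := by
        ring
      rw [ea, neg_sq] at h0
      exact h0
    rw [sum_add_distrib, sum_add_distrib, ← sum_div, ← mul_sum, ← mul_sum] at h
    rw [hR₂, hE, hΦ, hS]
    exact h
  -- assembly
  have hκS : n ^ 2 * (κ * (1 + ρ) / 2 * S) ≤ A / 8 := by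
    have h1 : κ * (1 + ρ) / 2 * S ≤ κ * (1 + ρ) / 2 * (2 * P.d * A) :=
      mul_le_mul_of_nonneg_left hS_le (by positivity)
    have h2 : n ^ 2 * (κ * (1 + ρ) / 2 * (2 * P.d * A)) = (8 * n ^ 2 * κ * P.d * (1 + ρ)) * A / 8 := by ring
    have h3 : (8 * n ^ 2 * κ * P.d * (1 + ρ)) * A / 8 ≤ 1 * A / 8 :=
      div_le_div_of_nonneg_right (mul_le_mul_of_nonneg_right hsmall hA0) (by norm_num)
    nlinarith [mul_le_mul_of_nonneg_left h1 hn2]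
  have hmain : A + n ^ 2 * (E / 2 - κ * (1 + ρ) / 2 * S) ≤ A / 4 + G + n ^ 2 * (E / 8 + 5 / 2 * Φ + κ * (1 + ρ) / 2 * S) := by
    have h1 : n ^ 2 * (E / 2 - κ * (1 + ρ) / 2 * S) ≤ n ^ 2 * I := mul_le_mul_of_nonneg_left hI_ge hn2
    have h2 : n ^ 2 * R₂ ≤ n ^ 2 * (E / 8 + 5 / 2 * Φ + κ * (1 + ρ) / 2 * S) := mul_le_mul_of_nonneg_left hR₂_le hn2
    linarith
  have hE' : 0 ≤ n ^ 2 * E := mul_nonneg hn2 hE0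
  nlinarith [hmain, hκS, hE', mul_nonneg hn2 hΦ0]

/-! ## §3. Bond sums; the column equation of the flat block propagator; the commutator with the cutoff; locality of the Neumann cut -/

/-- kernel: `Σ_b [y = b₋]φ(b) = Σ_μ φ⟨y,μ⟩` (bonds of the lattice (1.3) by initial point and direction). [cite: Balaban1983RegularityDecay, (1.3) p.572] -/
theorem sum_ite_src_eq (y : Balaban1983to89.Site P 0) (φ : PBond P 0 → ℝ) :
    ∑ b : PBond P 0, (if y = b.src then φ b else 0) = ∑ μ : Fin P.d, φ ⟨y, μ⟩ := by
  rw [Fintype.sum_equiv (⟨fun b => (b.src, b.dir), fun p => ⟨p.1, p.2⟩, fun _ => rfl, fun _ => rfl⟩ :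
      PBond P 0 ≃ Balaban1983to89.Site P 0 × Fin P.d)
    (fun b => if y = b.src then φ b else 0) (fun p => if y = p.1 then φ ⟨p.1, p.2⟩ else 0) (fun b => rfl),
    Fintype.sum_prod_type]
  rw [Finset.sum_eq_single y]
  · simp
  · intro z _ hz; simp [Ne.symm hz]
  · intro h; exact absurd (mem_univ _) h

/-- kernel: `Σ_b [y = b₊]φ(b) = Σ_μ φ⟨y−e_μ,μ⟩` (bonds of the lattice (1.3) by final point and direction). [cite: Balaban1983RegularityDecay, (1.3) p.572] -/
theorem sum_ite_tgt_eq (y : Balaban1983to89.Site P 0) (φ : PBond P 0 → ℝ) :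
    ∑ b : PBond P 0, (if y = b.tgt then φ b else 0) = ∑ μ : Fin P.d, φ ⟨y.unshift μ, μ⟩ := by
  rw [Fintype.sum_equiv (⟨fun b => (b.src, b.dir), fun p => ⟨p.1, p.2⟩, fun _ => rfl, fun _ => rfl⟩ :
      PBond P 0 ≃ Balaban1983to89.Site P 0 × Fin P.d)
    (fun b => if y = b.tgt then φ b else 0) (fun p => if y = p.1.shift p.2 then φ ⟨p.1, p.2⟩ else 0) (fun b => rfl),
    Fintype.sum_prod_type_right]
  refine sum_congr rfl fun μ _ => ?_
  rw [Finset.sum_eq_single (y.unshift μ)]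
  · have e : (y.unshift μ).shift μ = y := (shiftEquiv μ).right_inv y
    rw [if_pos e.symm]
  · intro z _ hz
    rw [if_neg]
    intro h
    apply hz
    have : z = (z.shift μ).unshift μ := ((shiftEquiv μ).left_inv z).symm
    rw [this, ← h]
  · intro h; exact absurd (mem_univ _) h

/-- kernel: on the whole torus every bond is in `T*`, and `lapN T` is the torus Laplacian in lattice units:
`(lapN univ φ)(y) = Σ_μ((φ(y) − φ(y+e_μ)) + (φ(y) − φ(y−e_μ)))`. [cite: Balaban1983RegularityDecay, (1.7) p.572] -/
theorem lapN_univ_mulVec_apply (φ : Balaban1983to89.Site P 0 → ℝ) (y : Balaban1983to89.Site P 0) :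
    (lapN univ *ᵥ φ) y = ∑ μ : Fin P.d, ((φ y - φ (y.shift μ)) + (φ y - φ (y.unshift μ))) := by
  rw [lapN_mulVec_apply]
  refine sum_congr rfl fun μ _ => ?_
  have h1 : (⟨y, μ⟩ : PBond P 0) ∈ starB (univ : Finset (Balaban1983to89.Site P 0)) :=
    (mem_starB _ _).2 ⟨mem_univ _, mem_univ _⟩
  have h2 : (⟨y.unshift μ, μ⟩ : PBond P 0) ∈ starB (univ : Finset (Balaban1983to89.Site P 0)) :=
    (mem_starB _ _).2 ⟨mem_univ _, mem_univ _⟩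
  rw [if_pos h1, if_pos h2]

/-- kernel: pv07's `H_0 = −Δ^ε` is `ε⁻²·lapN T`. [cite: Balaban1982Higgs1, (2.17) p.610] -/
theorem H_zero_mulVec_apply (φ : Balaban1983to89.Site P 0 → ℝ) (y : Balaban1983to89.Site P 0) :
    (H P 0 *ᵥ φ) y = (P.eps⁻¹) ^ 2 * (lapN univ *ᵥ φ) y := by
  rw [BIJ85FreeResolventTorus.H_mulVec_apply, zero_mul, zero_add, lapN_univ_mulVec_apply, mul_sum]

/-- **THE COLUMN EQUATION OF THE FLAT BLOCK PROPAGATOR IN LATTICE UNITS**: with `n = L^k`, `ū = G_k(T_ε,0)(·,x)`: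
`n²(lapN T ū)(y) + a_k(Q_k^*Q_kū)(y) = (L^kε)²[y = x]`. [cite: Balaban1982Higgs1, (2.20) p.610] -/
theorem tower_col_equation {a : ℝ} (ha : 0 < a) {k : ℕ} (hk : 1 ≤ k) (x y : Balaban1983to89.Site P 0) :
    ((P.L : ℝ) ^ k) ^ 2 * (lapN univ *ᵥ fun z => (tower P a 0).G k z x) y +
      B1.aSeq a P.L k * ((B1RG242Torus.Qks P k * B1RG242Torus.Qk P k) *ᵥ fun z => (tower P a 0).G k z x) y =
      P.spacing k ^ 2 * (if y = x then 1 else 0) := by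
  have hM := BIJ85FreeResolventTorus.towerOp_mul_G (P := P) ha hk
  -- the column `x` of `M·G = 1`
  have hcol : ((H P 0 + B1RG242Torus.α P a k • (B1RG242Torus.Qks P k * B1RG242Torus.Qk P k)) *ᵥ
      fun z => (tower P a 0).G k z x) y = if y = x then 1 else 0 := by
    have h := congr_fun (congr_fun hM y) x
    rw [Matrix.mul_apply, Matrix.one_apply] at h
    rw [mulVec, dotProduct]
    exact h
  rw [add_mulVec, smul_mulVec, Pi.add_apply, Pi.smul_apply, smul_eq_mul, H_zero_mulVec_apply] at hcol
  have hε : P.eps ≠ 0 := P.eps_pos.ne'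
  have hsp : P.spacing k = (P.L : ℝ) ^ k * P.eps := rfl
  have hα : B1RG242Torus.α P a k = B1.aSeq a P.L k * (P.spacing k ^ 2)⁻¹ := rfl
  have hsp0 : P.spacing k ≠ 0 := (P.spacing_pos k).ne'
  -- multiply by `sp²`
  have h2 := congr_arg (fun r => P.spacing k ^ 2 * r) hcol
  simp only [mul_add] at h2
  rw [hα] at h2
  have e1 : P.spacing k ^ 2 * ((P.eps⁻¹) ^ 2 * (lapN univ *ᵥ fun z => (tower P a 0).G k z x) y) =
      ((P.L : ℝ) ^ k) ^ 2 * (lapN univ *ᵥ fun z => (tower P a 0).G k z x) y := by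
    rw [hsp]; field_simp
  have e2 : P.spacing k ^ 2 * (B1.aSeq a P.L k * (P.spacing k ^ 2)⁻¹ *
      ((B1RG242Torus.Qks P k * B1RG242Torus.Qk P k) *ᵥ fun z => (tower P a 0).G k z x) y) =
      B1.aSeq a P.L k * ((B1RG242Torus.Qks P k * B1RG242Torus.Qk P k) *ᵥ fun z => (tower P a 0).G k z x) y := by
    field_simp
  rw [e1, e2] at h2
  exact h2

/-- **THE COMMUTATOR OF THE TORUS LAPLACIAN WITH A MULTIPLIER**: `(lapN T(χū))(y) − χ(y)(lapN T ū)(y) =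
Σ_μ((χ(y) − χ(y+e_μ))ū(y+e_μ) + (χ(y) − χ(y−e_μ))ū(y−e_μ))` — first differences of `χ` only ([6] (1.7) on the whole torus).
[cite: Balaban1983RegularityDecay, (1.7) p.572] -/
theorem lapN_univ_commutator (χ u : Balaban1983to89.Site P 0 → ℝ) (y : Balaban1983to89.Site P 0) :
    (lapN univ *ᵥ fun z => χ z * u z) y - χ y * (lapN univ *ᵥ u) y =
      ∑ μ : Fin P.d, ((χ y - χ (y.shift μ)) * u (y.shift μ) + (χ y - χ (y.unshift μ)) * u (y.unshift μ)) := by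
  rw [lapN_univ_mulVec_apply, lapN_univ_mulVec_apply, mul_sum, ← sum_sub_distrib]
  exact sum_congr rfl fun μ _ => by ring

/-- **LOCALITY OF THE NEUMANN CUT**: if every site within sup-distance `2r` of `x` lies in `Ω`, the Neumann Laplacian of `Ω` and the
torus Laplacian agree on `χ_{x,r}·u` (the cutoff vanishes off the ball of radius `2r − 1`, so no cut bond carries it).
[cite: Balaban1983RegularityDecay, (1.7) p.572] -/
theorem lapN_mulVec_chi_mul_eq {r : ℕ} (hr : 1 ≤ r) (Ω : Finset (Balaban1983to89.Site P 0)) (x : Balaban1983to89.Site P 0)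
    (hdeep : ∀ z, supDist x z ≤ 2 * r → z ∈ Ω) (u : Balaban1983to89.Site P 0 → ℝ) (y : Balaban1983to89.Site P 0) :
    (lapN Ω *ᵥ fun z => chi x r z * u z) y = (lapN univ *ᵥ fun z => chi x r z * u z) y := by
  rw [lapN_mulVec_apply, lapN_univ_mulVec_apply]
  refine sum_congr rfl fun μ _ => ?_
  -- a site carrying `χ ≠ 0` is `2r−1`-close to `x`, hence it and its neighbours are in `Ω`
  have key : ∀ z : Balaban1983to89.Site P 0, chi x r z ≠ 0 →
      z ∈ Ω ∧ (∀ ν, z.shift ν ∈ Ω) ∧ (∀ ν, z.unshift ν ∈ Ω) := by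
    intro z hz
    have h := supDist_lt_of_chi_ne_zero hr hz
    refine ⟨hdeep z (by omega), fun ν => hdeep _ ?_, fun ν => hdeep _ ?_⟩
    · have := supDist_shift_le_succ x z ν; omega
    · have := supDist_unshift_le_succ x z ν; omega
  congr 1
  · by_cases hb : (⟨y, μ⟩ : PBond P 0) ∈ starB Ω
    · rw [if_pos hb]
    · rw [if_neg hb]
      -- both `χ(y)` and `χ(y+e_μ)` vanish
      have hy : chi x r y = 0 := by
        by_contra h
        obtain ⟨h1, h2, -⟩ := key y h
        exact hb ((mem_starB Ω _).2 ⟨h1, h2 μ⟩)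
      have hy' : chi x r (y.shift μ) = 0 := by
        by_contra h
        obtain ⟨h1, -, h3⟩ := key _ h
        have e : (y.shift μ).unshift μ = y := (shiftEquiv μ).left_inv y
        have h3' := h3 μ
        rw [e] at h3'
        exact hb ((mem_starB Ω _).2 ⟨h3', h1⟩)
      rw [hy, hy']; ring
  · by_cases hb : (⟨y.unshift μ, μ⟩ : PBond P 0) ∈ starB Ω
    · rw [if_pos hb]
    · rw [if_neg hb]
      have e : (y.unshift μ).shift μ = y := (shiftEquiv μ).right_inv y
      have hy : chi x r y = 0 := by
        by_contra h
        obtain ⟨h1, -, h3⟩ := key y h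
        apply hb
        rw [mem_starB]
        exact ⟨h3 μ, by rw [show (⟨y.unshift μ, μ⟩ : PBond P 0).tgt = (y.unshift μ).shift μ from rfl, e]; exact h1⟩
      have hy' : chi x r (y.unshift μ) = 0 := by
        by_contra h
        obtain ⟨h1, h2, -⟩ := key _ h
        apply hb
        rw [mem_starB]
        refine ⟨h1, ?_⟩
        rw [show (⟨y.unshift μ, μ⟩ : PBond P 0).tgt = (y.unshift μ).shift μ from rfl, e]
        have := h2 μ; rw [e] at this; exact this
      rw [hy, hy']; ring

/-- kernel: the decomposition of the commutator into a bond DIVERGENCE of `D_b·m_b` (against p34's `v_b`) minus the symmetric remainder `c_E`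
(`D_b = χ(b₊) − χ(b₋)`, `m_b = ½(ū(b₋)+ū(b₊))`, `e_b = ½(ū(b₊) − ū(b₋))`), the bond sums running over `Ω*` when `D` vanishes off `Ω*`
([6] (1.7): the bonds of `Ω*`). [cite: Balaban1983RegularityDecay, (1.7) p.572] -/
theorem commutator_decomposition (Ω : Finset (Balaban1983to89.Site P 0)) (χ u : Balaban1983to89.Site P 0 → ℝ)
    (hD : ∀ b : PBond P 0, b ∉ starB Ω → χ b.tgt - χ b.src = 0) (y : Balaban1983to89.Site P 0) :
    ∑ μ : Fin P.d, ((χ y - χ (y.shift μ)) * u (y.shift μ) + (χ y - χ (y.unshift μ)) * u (y.unshift μ)) =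
      ∑ b ∈ starB Ω, ((χ b.tgt - χ b.src) * ((u b.src + u b.tgt) / 2)) * bvec b y -
        ∑ b ∈ starB Ω, ((if y = b.src then (1 : ℝ) else 0) + (if y = b.tgt then 1 else 0)) *
          ((χ b.tgt - χ b.src) * ((u b.tgt - u b.src) / 2)) := by
  -- combine the two `Ω*`-sums bondwise
  rw [← sum_sub_distrib]
  have e1 : ∀ b : PBond P 0, ((χ b.tgt - χ b.src) * ((u b.src + u b.tgt) / 2)) * bvec b y -
      ((if y = b.src then (1 : ℝ) else 0) + (if y = b.tgt then 1 else 0)) * ((χ b.tgt - χ b.src) * ((u b.tgt - u b.src) / 2)) =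
      (if y = b.tgt then (χ b.tgt - χ b.src) * u b.src else 0) - (if y = b.src then (χ b.tgt - χ b.src) * u b.tgt else 0) := by
    intro b; rw [bvec_apply]; split_ifs <;> ring
  rw [sum_congr rfl fun b _ => e1 b]
  -- extend to all bonds (the summand vanishes off `Ω*`)
  rw [Finset.sum_subset (subset_univ (starB Ω)) (fun b _ hb => by rw [hD b hb]; simp)]
  rw [sum_sub_distrib, sum_ite_tgt_eq, sum_ite_src_eq, ← sum_sub_distrib]
  refine sum_congr rfl fun μ _ => ?_
  have e2 : (⟨y.unshift μ, μ⟩ : PBond P 0).tgt = y := (shiftEquiv μ).right_inv y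
  simp only [e2]
  show (χ y - χ (y.shift μ)) * u (y.shift μ) + (χ y - χ (y.unshift μ)) * u (y.unshift μ) =
    (χ y - χ (y.unshift μ)) * u (y.unshift μ) - (χ ((⟨y, μ⟩ : PBond P 0).tgt) - χ y) * u ((⟨y, μ⟩ : PBond P 0).tgt)
  rw [show (⟨y, μ⟩ : PBond P 0).tgt = y.shift μ from rfl]
  ring

/-! ## §4. The free tilted row of the massive Neumann resolvent of a region at deep rows -/

/-- kernel: `((a+b)/2)² ≤ (a²+b²)/2`. [folklore] -/
private theorem sq_half_sum_le (a b : ℝ) : ((a + b) / 2) ^ 2 ≤ (a ^ 2 + b ^ 2) / 2 := by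
  nlinarith [sq_nonneg (a - b)]

/-- kernel: `(p − q − r)² ≤ 3(p² + q² + r²)`. [folklore] -/
private theorem sub_sub_sq_le (p q r : ℝ) : (p - q - r) ^ 2 ≤ 3 * (p ^ 2 + q ^ 2 + r ^ 2) := by
  nlinarith [sq_nonneg (p + q), sq_nonneg (q - r), sq_nonneg (p + r)]

/-- kernel: `(a − c·b)² ≤ 2a² + 2c²b²`. [folklore] -/
private theorem sub_mul_sq_le (a b c : ℝ) : (a - c * b) ^ 2 ≤ 2 * a ^ 2 + 2 * (c ^ 2 * b ^ 2) := by
  nlinarith [sq_nonneg (a + c * b)]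

/-- kernel: the weighted cross bound `½(w₋²+w₊²)·½(u₋²+u₊²) ≤ ¼(1+ρ)((w₋u₋)² + (w₊u₊)²)` under the squared ratio bounds. [folklore] -/
private theorem weight_cross_le {ws wt us ut ρ : ℝ} (hr1 : ws ^ 2 ≤ ρ * wt ^ 2) (hr2 : wt ^ 2 ≤ ρ * ws ^ 2) :
    (ws ^ 2 + wt ^ 2) / 2 * ((us ^ 2 + ut ^ 2) / 2) ≤ (1 + ρ) / 4 * ((ws * us) ^ 2 + (wt * ut) ^ 2) := by
  have h3 : ws ^ 2 * ut ^ 2 ≤ ρ * wt ^ 2 * ut ^ 2 := mul_le_mul_of_nonneg_right hr1 (sq_nonneg _)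
  have h4 : wt ^ 2 * us ^ 2 ≤ ρ * ws ^ 2 * us ^ 2 := mul_le_mul_of_nonneg_right hr2 (sq_nonneg _)
  have e1 : (ws ^ 2 + wt ^ 2) / 2 * ((us ^ 2 + ut ^ 2) / 2) =
      ((ws ^ 2 * us ^ 2 + wt ^ 2 * ut ^ 2) + (ws ^ 2 * ut ^ 2 + wt ^ 2 * us ^ 2)) / 4 := by ring
  have e2 : (1 + ρ) / 4 * ((ws * us) ^ 2 + (wt * ut) ^ 2) =
      ((ws ^ 2 * us ^ 2 + wt ^ 2 * ut ^ 2) + (ρ * ws ^ 2 * us ^ 2 + ρ * wt ^ 2 * ut ^ 2)) / 4 := by ring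
  rw [e1, e2]
  exact div_le_div_of_nonneg_right (by linarith) (by norm_num)

/-- kernel: the squared neighbour ratio of the exponential weight `w = e^{t|x−·|_∞/L^k}`: `w(z+e_μ)² ≤ e^{2t/L^k}w(z)²` and conversely
(`t ≥ 0`; companion of `weight_bond_osc_sq`). [cite: BalabanImbrieJaffe1985, (7.3.2) p.326] -/
theorem weight_ratio_sq {t : ℝ} (ht : 0 ≤ t) (k : ℕ) (x z : Balaban1983to89.Site P 0) (μ : Fin P.d) :
    Real.exp (t * (supDist x z : ℝ) / (P.L : ℝ) ^ k) ^ 2 ≤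
        Real.exp (2 * t / (P.L : ℝ) ^ k) * Real.exp (t * (supDist x (z.shift μ) : ℝ) / (P.L : ℝ) ^ k) ^ 2 ∧
      Real.exp (t * (supDist x (z.shift μ) : ℝ) / (P.L : ℝ) ^ k) ^ 2 ≤
        Real.exp (2 * t / (P.L : ℝ) ^ k) * Real.exp (t * (supDist x z : ℝ) / (P.L : ℝ) ^ k) ^ 2 := by
  have hn : 0 < (P.L : ℝ) ^ k := pow_pos P.cast_L_pos k
  have hd := abs_supDist_shift_sub_le x z μ
  rw [abs_le] at hd
  constructor
  · rw [← Real.exp_nat_mul, ← Real.exp_nat_mul, ← Real.exp_add, Real.exp_le_exp]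
    push_cast
    rw [show (2:ℝ) * (t * (supDist x z : ℝ) / (P.L : ℝ) ^ k) = (2 * t * (supDist x z : ℝ)) / (P.L : ℝ) ^ k by ring,
      show 2 * t / (P.L : ℝ) ^ k + 2 * (t * (supDist x (z.shift μ) : ℝ) / (P.L : ℝ) ^ k) =
        (2 * t + 2 * t * (supDist x (z.shift μ) : ℝ)) / (P.L : ℝ) ^ k by ring]
    refine div_le_div_of_nonneg_right ?_ hn.le
    nlinarith only [hd.1, hd.2, ht]
  · rw [← Real.exp_nat_mul, ← Real.exp_nat_mul, ← Real.exp_add, Real.exp_le_exp]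
    push_cast
    rw [show (2:ℝ) * (t * (supDist x (z.shift μ) : ℝ) / (P.L : ℝ) ^ k) = (2 * t * (supDist x (z.shift μ) : ℝ)) / (P.L : ℝ) ^ k by ring,
      show 2 * t / (P.L : ℝ) ^ k + 2 * (t * (supDist x z : ℝ) / (P.L : ℝ) ^ k) =
        (2 * t + 2 * t * (supDist x z : ℝ)) / (P.L : ℝ) ^ k by ring]
    refine div_le_div_of_nonneg_right ?_ hn.le
    nlinarith only [hd.1, hd.2, ht]

set_option maxHeartbeats 1600000 in
/-- **THE FREE TILTED ROW OF A REGION AT DEEP ROWS**: there are `t₀, C₀ > 0` (functions of `d, L`) such that for every volume, every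
`1 ≤ k ≤ K` with `4L^k + 6 ≤ |T|`, every region `Ω ⊆ T^{(0)}`, every site `x` whose sup-ball of radius `2L^k + 1` lies in `Ω` and every
`0 ≤ t ≤ t₀`, the free massive Neumann resolvent `R_Ω = (L^{2k}(−Δ^N_Ω) + 1)⁻¹` of the region obeys
`Σ_z (e^{t|x−z|_∞/L^k}R_Ω(x,z))² ≤ C₀L^{−kd}` — the `ℓ² → ℓ^∞` smoothing input of the sup-norm (1.10) member for region propagators
at the rows [6] keeps (`dist(x, Ω^c) ≥ R₀`), by COMPARISON WITH THE TORUS: cut-off flat block propagator `χū`, the exact identity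
`(L^kε)²R_Ω(·,x) = χū − R_Ω[χ(ū − a_kQ^*Qū)] − L^{2k}R_Ω[−Δ,χ]ū`, the torus tilted row, the weighted energy inequality.
[cite: Balaban1983RegularityDecay, (1.10) p.573] -/
theorem tilted_row_regionR_sq_le_deep (d L : ℕ) (hd : 1 ≤ d) (hd3 : d ≤ 3) (hL : Odd L ∧ 1 < L) :
    ∃ t₀ C₀ : ℝ, 0 < t₀ ∧ 0 < C₀ ∧ ∀ (P : Params), P.d = d → P.L = L →
      ∀ k : ℕ, 1 ≤ k → k ≤ P.K → 4 * P.L ^ k + 6 ≤ P.sitesPerDir 0 →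
      ∀ (Ω : Finset (Balaban1983to89.Site P 0)) (x : Balaban1983to89.Site P 0),
        (∀ z, supDist x z ≤ 2 * P.L ^ k + 1 → z ∈ Ω) →
      ∀ t : ℝ, 0 ≤ t → t ≤ t₀ →
        ∑ z, (Real.exp (t * (supDist x z : ℝ) / (P.L : ℝ) ^ k) * ((((P.L : ℝ) ^ k) ^ 2) • lapN Ω + 1)⁻¹ x z) ^ 2 ≤
          C₀ / (P.L : ℝ) ^ (k * P.d) := by
  obtain ⟨t₁, C₁, ht₁, hC₁, hG⟩ := tilted_row_G_sq_le d L hd hd3 hL (a := 1) one_pos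
  obtain ⟨C_B, hCB, hdiff⟩ := annulus_diff_bound d L hd hL (a := 1) one_pos
  set e2 : ℝ := Real.exp 2 with he2
  set tb : ℝ := 1 / (8 * Real.exp 1 * d * (1 + e2)) with htb
  have htbpos : 0 < tb := by positivity
  set C₀ : ℝ := 3 * (C₁ + (4 * C₁ + 4 * e2 * C₁) + (2 * (7 ^ d * Real.exp 6 * d ^ 2 * C_B ^ 2) + 5 / 2 * (1 + e2) * d * C₁))
    with hC₀
  refine ⟨min t₁ (min 1 tb), C₀, lt_min ht₁ (lt_min one_pos htbpos), by positivity, ?_⟩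
  intro P hPd hPL k hk1 hkK hN Ω x hdeep t ht0 ht1
  have htt₁ : t ≤ t₁ := ht1.trans (min_le_left _ _)
  have ht1' : t ≤ 1 := ht1.trans ((min_le_right _ _).trans (min_le_left _ _))
  have httb : t ≤ tb := ht1.trans ((min_le_right _ _).trans (min_le_right _ _))
  have hG1 := hG P hPd hPL k hk1 hkK t ht0 htt₁ x
  have hdiff1 := hdiff P hPd hPL k hk1 hkK x
  subst hPd; subst hPL
  have hk : k ≤ P.m + P.K := hkK.trans (Nat.le_add_left _ _)
  have hLpos : (0 : ℝ) < P.L := P.cast_L_pos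
  have hL1 : (1 : ℝ) < P.L := by exact_mod_cast hL.2
  have hεpos : 0 < P.eps := P.eps_pos
  have hsp : 0 < P.spacing k := P.spacing_pos k
  -- names
  set nN : ℕ := P.L ^ k with hnN
  set n : ℝ := (P.L : ℝ) ^ k with hn
  have hnNn : (nN : ℝ) = n := by rw [hnN, hn]; push_cast; ring
  have hnpos : 0 < n := pow_pos hLpos k
  have hn1 : 1 ≤ n := one_le_pow₀ hL1.le
  have hnN1 : 1 ≤ nN := Nat.one_le_pow _ _ P.L_pos
  set s : ℝ := n ^ 2 with hs
  have hs0 : 0 ≤ s := sq_nonneg _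
  set sp : ℝ := P.spacing k with hspdef
  set N : ℝ := (P.L : ℝ) ^ (k * P.d) with hNdef
  have hNpos : 0 < N := pow_pos hLpos _
  have hNn : N = n ^ P.d := by rw [hNdef, hn, ← pow_mul]
  set R : Matrix (Balaban1983to89.Site P 0) (Balaban1983to89.Site P 0) ℝ := (s • lapN Ω + 1)⁻¹ with hR
  set ub : Balaban1983to89.Site P 0 → ℝ := fun z => (tower P 1 0).G k z x with hub
  set χ : Balaban1983to89.Site P 0 → ℝ := fun z => chi x nN z with hχ
  set w : Balaban1983to89.Site P 0 → ℝ := fun z => Real.exp (t * (supDist x z : ℝ) / (P.L : ℝ) ^ k) with hw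
  have hwpos : ∀ z, 0 < w z := fun z => Real.exp_pos _
  set QQ : Matrix (Balaban1983to89.Site P 0) (Balaban1983to89.Site P 0) ℝ := B1RG242Torus.Qks P k * B1RG242Torus.Qk P k with hQQ
  set aK : ℝ := B1.aSeq 1 P.L k with haK
  have haK0 : 0 ≤ aK := (B1.aSeq_pos one_pos hL1 hk1).le
  have haK1 : aK ≤ 1 := B1.aSeq_le one_pos hL1 k hk1
  set g₁ : Balaban1983to89.Site P 0 → ℝ := fun z => χ z * (ub z - aK * (QQ *ᵥ ub) z) with hg₁
  set comm : Balaban1983to89.Site P 0 → ℝ := fun y =>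
    ∑ μ : Fin P.d, ((χ y - χ (y.shift μ)) * ub (y.shift μ) + (χ y - χ (y.unshift μ)) * ub (y.unshift μ)) with hcomm
  set f₁ : Balaban1983to89.Site P 0 → ℝ := R *ᵥ g₁ with hf₁
  set f₂ : Balaban1983to89.Site P 0 → ℝ := R *ᵥ fun y => n ^ 2 * comm y with hf₂
  -- deepness consequences
  have hdeep2 : ∀ z, supDist x z ≤ 2 * nN → z ∈ Ω := fun z hz => hdeep z (by omega)
  have hχx : χ x = 1 := chi_eq_one_of_supDist_le (by rw [(B3TorusRadialSums.supDist_eq_zero_iff x x).2 rfl]; exact Nat.zero_le _)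
  -- STEP A1: the mass operator on `χū`
  have hmass : ∀ y, ((s • lapN Ω + 1) *ᵥ fun z => χ z * ub z) y =
      sp ^ 2 * (if y = x then 1 else 0) + g₁ y + n ^ 2 * comm y := by
    intro y
    rw [massOp_mulVec_apply, lapN_mulVec_chi_mul_eq hnN1 Ω x hdeep2 ub y]
    have hc := lapN_univ_commutator χ ub y
    have hcol := tower_col_equation (P := P) one_pos hk1 x y
    rw [← hQQ, ← haK, ← hn] at hcol
    have e1 : (lapN univ *ᵥ fun z => χ z * ub z) y = χ y * (lapN univ *ᵥ ub) y + comm y := by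
      rw [hcomm]; linarith [hc]
    rw [e1, hs]
    -- `n²χ(y)(lapN T ū)(y) = χ(y)(sp²δ − a_k QQū)`
    have e2 : n ^ 2 * (χ y * (lapN univ *ᵥ ub) y) = χ y * (sp ^ 2 * (if y = x then 1 else 0) - aK * (QQ *ᵥ ub) y) := by
      have : n ^ 2 * (lapN univ *ᵥ ub) y = sp ^ 2 * (if y = x then 1 else 0) - aK * (QQ *ᵥ ub) y := by
        rw [hub]; linarith [hcol]
      rw [← this]; ring
    have e3 : χ y * (sp ^ 2 * (if y = x then 1 else 0)) = sp ^ 2 * (if y = x then 1 else 0) := by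
      by_cases hy : y = x
      · rw [if_pos hy, hy, hχx]; ring
      · rw [if_neg hy]; ring
    calc n ^ 2 * (χ y * (lapN univ *ᵥ ub) y + comm y) + χ y * ub y
        = χ y * (sp ^ 2 * (if y = x then 1 else 0)) - χ y * (aK * (QQ *ᵥ ub) y) + n ^ 2 * comm y + χ y * ub y := by
          rw [mul_add, e2]; ring
      _ = sp ^ 2 * (if y = x then 1 else 0) + g₁ y + n ^ 2 * comm y := by rw [e3, hg₁]; ring
  -- STEP A2: apply `R`: `χū = sp²·Rδ_x + f₁ + f₂`, and `(Rδ_x)(z) = R(x,z)`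
  have hident : ∀ z, sp ^ 2 * R x z = χ z * ub z - f₁ z - f₂ z := by
    intro z
    have h1 : (R *ᵥ ((s • lapN Ω + 1) *ᵥ fun z => χ z * ub z)) z = χ z * ub z := by
      rw [mulVec_mulVec, hR, inv_mul_massOp hs0, one_mulVec]
    have hsrc : ((s • lapN Ω + 1) *ᵥ fun z => χ z * ub z) =
        (sp ^ 2 • (Pi.single x (1 : ℝ) : Balaban1983to89.Site P 0 → ℝ)) + g₁ + fun y => n ^ 2 * comm y := by
      funext y
      rw [hmass y, Pi.add_apply, Pi.add_apply, Pi.smul_apply, smul_eq_mul, Pi.single_apply]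
    rw [hsrc, mulVec_add, mulVec_add, mulVec_smul, Pi.add_apply, Pi.add_apply, Pi.smul_apply, smul_eq_mul] at h1
    have hcol : (R *ᵥ (Pi.single x (1 : ℝ))) z = R x z := by
      rw [mulVec_single, MulOpposite.op_one, one_smul, Matrix.col_apply]
      calc R z x = Rᵀ x z := rfl
        _ = R x z := by rw [hR, inv_massOp_transpose]
    rw [hcol] at h1
    rw [hf₁, hf₂]
    linarith
  -- STEP B0: weight facts for the energy inequality
  set κ : ℝ := (t / (P.L : ℝ) ^ k) ^ 2 * Real.exp (t / (P.L : ℝ) ^ k) with hκ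
  set ρ : ℝ := Real.exp (2 * t / (P.L : ℝ) ^ k) with hρ
  have hκ0 : 0 ≤ κ := by positivity
  have hρ0 : 0 ≤ ρ := (Real.exp_pos _).le
  have hρe2 : ρ ≤ e2 := by
    rw [hρ, he2, Real.exp_le_exp]
    calc 2 * t / (P.L : ℝ) ^ k ≤ 2 * t := div_le_self (by positivity) hn1
      _ ≤ 2 := by linarith only [ht1']
  have hosc : ∀ b ∈ starB Ω, (w b.tgt - w b.src) ^ 2 ≤ κ * (w b.src * w b.tgt) := by
    intro b _
    have h := weight_bond_osc_sq (s := t) (le_of_eq (abs_of_nonneg ht0)) k x b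
    simp only [hw, hκ]
    rw [mul_comm (Real.exp (t * (supDist x b.src : ℝ) / (P.L : ℝ) ^ k))]
    exact h
  have hrat : ∀ b ∈ starB Ω, w b.src ^ 2 ≤ ρ * w b.tgt ^ 2 ∧ w b.tgt ^ 2 ≤ ρ * w b.src ^ 2 := by
    intro b _
    have h := weight_ratio_sq ht0 k x b.src b.dir
    exact ⟨h.1, h.2⟩
  have hsmall : 8 * n ^ 2 * κ * P.d * (1 + ρ) ≤ 1 := by
    -- `n²κ = t²e^{t/n} ≤ t·e` (t ≤ 1), so `8n²κd(1+ρ) ≤ 8e d(1+e²)·t ≤ 1`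
    have h1 : n ^ 2 * κ = t ^ 2 * Real.exp (t / n) := by rw [hκ, hn]; field_simp
    have h2 : Real.exp (t / n) ≤ Real.exp 1 := Real.exp_le_exp.2 ((div_le_self ht0 hn1).trans ht1')
    have h3 : t ^ 2 ≤ t := by nlinarith only [ht0, ht1']
    have h4 : n ^ 2 * κ ≤ t * Real.exp 1 := by
      rw [h1]; exact mul_le_mul h3 h2 (Real.exp_pos _).le ht0
    have hd0 : (0 : ℝ) < P.d := by exact_mod_cast hd
    have h5 : 8 * n ^ 2 * κ * P.d * (1 + ρ) ≤ 8 * (t * Real.exp 1) * P.d * (1 + e2) := by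
      have h := mul_le_mul h4 (show 1 + ρ ≤ 1 + e2 by linarith only [hρe2]) (by positivity) (by positivity)
      have h' := mul_le_mul_of_nonneg_left h (by positivity : (0:ℝ) ≤ 8 * P.d)
      have e1 : 8 * n ^ 2 * κ * P.d * (1 + ρ) = 8 * P.d * (n ^ 2 * κ * (1 + ρ)) := by ring
      have e2' : 8 * (t * Real.exp 1) * P.d * (1 + e2) = 8 * P.d * (t * Real.exp 1 * (1 + e2)) := by ring
      rw [e1, e2']; exact h'
    have h6 : 8 * (t * Real.exp 1) * P.d * (1 + e2) = t * (8 * Real.exp 1 * P.d * (1 + e2)) := by ring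
    have h7 : t * (8 * Real.exp 1 * P.d * (1 + e2)) ≤ tb * (8 * Real.exp 1 * P.d * (1 + e2)) :=
      mul_le_mul_of_nonneg_right httb (by positivity)
    have h8 : tb * (8 * Real.exp 1 * P.d * (1 + e2)) = 1 := by
      have : (0:ℝ) < 1 + e2 := by positivity
      rw [htb]; field_simp
    linarith
  -- common quantities
  set S₀ : ℝ := sp ^ 4 / N with hS₀
  have hS₀nn : 0 ≤ S₀ := by positivity
  set A₀ : ℝ := ∑ z, (w z * ub z) ^ 2 with hA₀
  have hA₀le : A₀ ≤ C₁ * S₀ := hG1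
  have hA₀nn : 0 ≤ A₀ := sum_nonneg fun z _ => sq_nonneg _
  have he2t : Real.exp (2 * t) ≤ e2 := by rw [he2]; exact Real.exp_le_exp.2 (by linarith only [ht1'])
  -- STEP B1: `T1 = Σ(wχū)² ≤ A₀`
  have hT1 : ∑ z, (w z * (χ z * ub z)) ^ 2 ≤ C₁ * S₀ := by
    refine (sum_le_sum fun z _ => ?_).trans hA₀le
    have hc0 : 0 ≤ χ z := chi_nonneg x nN z
    have hc1 : χ z ≤ 1 := chi_le_one hnN1 x z
    have e : (w z * (χ z * ub z)) ^ 2 = χ z ^ 2 * (w z * ub z) ^ 2 := by ring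
    rw [e]
    have : χ z ^ 2 ≤ 1 := by rw [sq]; exact mul_le_one₀ hc1 hc0 hc1
    exact (mul_le_of_le_one_left (sq_nonneg _) this)
  -- STEP B2: `T2 = Σ(wf₁)² ≤ (4C₁ + 4e²C₁)S₀`
  have hmassR : ∀ (g : Balaban1983to89.Site P 0 → ℝ) (y : Balaban1983to89.Site P 0),
      (R *ᵥ g) y + n ^ 2 * ∑ b ∈ starB Ω, ((R *ᵥ g) b.tgt - (R *ᵥ g) b.src) * bvec b y = g y := by
    intro g y
    have h := congr_fun (show (s • lapN Ω + 1) *ᵥ (R *ᵥ g) = g by rw [mulVec_mulVec, hR, massOp_mul_inv hs0, one_mulVec]) y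
    rw [massOp_mulVec_apply, lapN_mulVec_eq_sum] at h
    rw [hs] at h
    linarith only [h]
  have hQQ_le : ∑ z, (w z * (QQ *ᵥ ub) z) ^ 2 ≤ Real.exp (2 * t) * A₀ := by
    have hoscω : ∀ z z' : Balaban1983to89.Site P 0,
        Balaban1983to89.Site.proj k k z' = Balaban1983to89.Site.proj k k z → w z ≤ Real.exp t * w z' :=
      fun z z' hzz => weight_block_osc ht0 hk x z z' hzz
    exact tilted_sq_QQ_le hk hwpos hoscω ub
  have hT2 : ∑ z, (w z * f₁ z) ^ 2 ≤ (4 * C₁ + 4 * e2 * C₁) * S₀ := by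
    have hE := energy_weighted (starB Ω) (n := n) (F := fun _ => (0 : ℝ)) (g := g₁) (f := f₁) hwpos hκ0 hρ0 hosc hrat hsmall
      (fun y => by rw [hf₁, hmassR g₁ y]; simp)
    have hg : ∑ z, (w z * g₁ z) ^ 2 ≤ 2 * A₀ + 2 * (Real.exp (2 * t) * A₀) := by
      have hpt : ∀ z, (w z * g₁ z) ^ 2 ≤ 2 * (w z * ub z) ^ 2 + 2 * (aK ^ 2 * (w z * (QQ *ᵥ ub) z) ^ 2) := by
        intro z
        have hc0 : 0 ≤ χ z := chi_nonneg x nN z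
        have hc1 : χ z ≤ 1 := chi_le_one hnN1 x z
        have hχ2 : χ z ^ 2 ≤ 1 := by rw [sq]; exact mul_le_one₀ hc1 hc0 hc1
        have e : (w z * g₁ z) ^ 2 = χ z ^ 2 * (w z * ub z - aK * (w z * (QQ *ᵥ ub) z)) ^ 2 := by rw [hg₁]; ring
        rw [e]
        have h2 : (w z * ub z - aK * (w z * (QQ *ᵥ ub) z)) ^ 2 ≤
            2 * (w z * ub z) ^ 2 + 2 * (aK ^ 2 * (w z * (QQ *ᵥ ub) z) ^ 2) := sub_mul_sq_le _ _ _
        exact (mul_le_of_le_one_left (sq_nonneg _) hχ2).trans h2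
      have haK2 : aK ^ 2 ≤ 1 := by rw [sq]; exact mul_le_one₀ haK1 haK0 haK1
      calc ∑ z, (w z * g₁ z) ^ 2 ≤ ∑ z, (2 * (w z * ub z) ^ 2 + 2 * (aK ^ 2 * (w z * (QQ *ᵥ ub) z) ^ 2)) := sum_le_sum fun z _ => hpt z
        _ = 2 * A₀ + 2 * aK ^ 2 * ∑ z, (w z * (QQ *ᵥ ub) z) ^ 2 := by
            rw [sum_add_distrib, ← mul_sum, ← mul_sum, ← mul_sum, hA₀]; ring
        _ ≤ 2 * A₀ + 2 * 1 * (Real.exp (2 * t) * A₀) := by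
            have := mul_le_mul haK2 hQQ_le (sum_nonneg fun z _ => sq_nonneg _) zero_le_one
            linarith only [this]
        _ = 2 * A₀ + 2 * (Real.exp (2 * t) * A₀) := by ring
    have hF0 : ∑ b ∈ starB Ω, (w b.src ^ 2 + w b.tgt ^ 2) / 2 * (0 : ℝ) ^ 2 = 0 := by simp
    rw [hF0, mul_zero, add_zero] at hE
    have h3 : Real.exp (2 * t) * A₀ ≤ e2 * (C₁ * S₀) := mul_le_mul he2t hA₀le hA₀nn (by positivity)
    linarith only [hE, hg, h3, hA₀le]
  -- STEP B3: `T3 = Σ(wf₂)²`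
  -- the bond data of the commutator
  set D : PBond P 0 → ℝ := fun b => χ b.tgt - χ b.src with hDdef
  set mB : PBond P 0 → ℝ := fun b => (ub b.src + ub b.tgt) / 2 with hmB
  set eB : PBond P 0 → ℝ := fun b => (ub b.tgt - ub b.src) / 2 with heB
  set cE : Balaban1983to89.Site P 0 → ℝ := fun y =>
    ∑ b ∈ starB Ω, ((if y = b.src then (1 : ℝ) else 0) + (if y = b.tgt then 1 else 0)) * (D b * eB b) with hcE
  -- `D` vanishes off `Ω*`
  have hχzero : ∀ z, z ∉ Ω → χ z = 0 := by
    intro z hz; by_contra h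
    exact hz (hdeep2 z (supDist_lt_of_chi_ne_zero hnN1 h).le)
  have hD0 : ∀ b : PBond P 0, b ∉ starB Ω → D b = 0 := by
    intro b hb
    rw [mem_starB, not_and_or] at hb
    have hs' : χ b.src = 0 := by
      by_contra h
      have h1 := supDist_lt_of_chi_ne_zero hnN1 h
      have hsrc : b.src ∈ Ω := hdeep2 _ h1.le
      have htgt : b.tgt ∈ Ω := hdeep2 _ (by have := supDist_shift_le_succ x b.src b.dir; rw [show b.tgt = b.src.shift b.dir from rfl]; omega)
      rcases hb with h' | h' <;> contradiction
    have ht' : χ b.tgt = 0 := by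
      by_contra h
      have h1 := supDist_lt_of_chi_ne_zero hnN1 h
      have htgt : b.tgt ∈ Ω := hdeep2 _ h1.le
      have hsrc : b.src ∈ Ω := hdeep2 _ (by
        have := supDist_le_shift_succ x b.src b.dir; rw [show b.src.shift b.dir = b.tgt from rfl] at this; omega)
      rcases hb with h' | h' <;> contradiction
    simp only [hDdef, hs', ht', sub_zero]
  -- the decomposition `comm = div(D·m) − cE`
  have hdecomp : ∀ y, comm y = ∑ b ∈ starB Ω, (D b * mB b) * bvec b y - cE y := by
    intro y
    have h := commutator_decomposition Ω χ ub hD0 y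
    rw [hcomm]
    exact h
  -- the per-bond bounds: `|D| ≤ 1/n`, and `|D·e| ≤ K`
  set K : ℝ := (1 / n) * (C_B * (sp ^ 2 / (N * n))) / 2 with hK
  have hK0 : 0 ≤ K := by positivity
  have hDle : ∀ b : PBond P 0, |D b| ≤ 1 / n := by
    intro b
    have h := abs_chi_shift_sub_le hnN1 hN x b.src b.dir
    rw [hnNn] at h
    have e : D b = chi x nN (b.src.shift b.dir) - chi x nN b.src := by
      simp only [hDdef, hχ, show b.tgt = b.src.shift b.dir from rfl]
    rw [e]; exact h
  have hDe : ∀ b : PBond P 0, |D b * eB b| ≤ K := by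
    intro b
    by_cases hDb : D b = 0
    · rw [hDb, zero_mul, abs_zero]; exact hK0
    · have hne : chi x nN (b.src.shift b.dir) ≠ chi x nN b.src := by
        intro h; apply hDb
        simp only [hDdef, hχ, show b.tgt = b.src.shift b.dir from rfl, h, sub_self]
      have hfar := le_supDist_of_chi_shift_ne hnN1 hN hne
      have hfar' : (P.L : ℝ) ^ k ≤ (supDist x b.src : ℝ) + 1 := by
        rw [← hn, ← hnNn]; exact_mod_cast hfar
      have hd' := hdiff1 b.src b.dir hfar'
      rw [abs_mul]
      have he' : |eB b| ≤ C_B * (sp ^ 2 / (N * n)) / 2 := by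
        rw [heB]
        simp only
        rw [abs_div, abs_two, show b.tgt = b.src.shift b.dir from rfl, hub]
        exact div_le_div_of_nonneg_right hd' zero_le_two
      calc |D b| * |eB b| ≤ (1 / n) * (C_B * (sp ^ 2 / (N * n)) / 2) :=
            mul_le_mul (hDle b) he' (abs_nonneg _) (by positivity)
        _ = K := by rw [hK]; ring
  -- pointwise bound and support of `cE`
  have hcE_le : ∀ y, |cE y| ≤ 2 * P.d * K := by
    intro y
    rw [hcE]
    calc |∑ b ∈ starB Ω, ((if y = b.src then (1 : ℝ) else 0) + (if y = b.tgt then 1 else 0)) * (D b * eB b)|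
        ≤ ∑ b ∈ starB Ω, |((if y = b.src then (1 : ℝ) else 0) + (if y = b.tgt then 1 else 0)) * (D b * eB b)| :=
          abs_sum_le_sum_abs _ _
      _ ≤ ∑ b ∈ starB Ω, ((if y = b.src then (1 : ℝ) else 0) + (if y = b.tgt then 1 else 0)) * K :=
          sum_le_sum fun b _ => by
            rw [abs_mul, abs_of_nonneg (by positivity)]
            exact mul_le_mul_of_nonneg_left (hDe b) (by positivity)
      _ ≤ ∑ b : PBond P 0, ((if y = b.src then (1 : ℝ) else 0) + (if y = b.tgt then 1 else 0)) * K :=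
          sum_le_univ_sum_of_nonneg fun b => by positivity
      _ = 2 * P.d * K := by
          rw [← sum_mul, sum_add_distrib, sum_ite_src_eq y (fun _ => (1:ℝ)), sum_ite_tgt_eq y (fun _ => (1:ℝ))]
          simp only [sum_const, card_univ, Fintype.card_fin, nsmul_eq_mul, mul_one]; ring
  have hcE_zero : ∀ y, 2 * nN + 1 < supDist x y → cE y = 0 := by
    intro y hy
    rw [hcE]
    refine sum_eq_zero fun b _ => ?_
    by_cases hDb : D b = 0
    · rw [hDb, zero_mul, mul_zero]
    · have hne : chi x nN (b.src.shift b.dir) ≠ chi x nN b.src := by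
        intro h; apply hDb
        simp only [hDdef, hχ, show b.tgt = b.src.shift b.dir from rfl, h, sub_self]
      have hcl := supDist_le_of_chi_shift_ne hnN1 hne
      have h1 : y ≠ b.src := by intro h; rw [h] at hy; omega
      have h2 : y ≠ b.tgt := by
        intro h; rw [h, show b.tgt = b.src.shift b.dir from rfl] at hy
        have := supDist_shift_le_succ x b.src b.dir; omega
      rw [if_neg h1, if_neg h2, add_zero, zero_mul]
  have hcard : ((ball x (2 * nN + 1)).card : ℝ) ≤ 7 ^ P.d * N := by
    have h := card_ball_le x (2 * nN + 1)
    have h2 : (2 * (2 * nN + 1) + 1) ^ P.d ≤ (7 * nN) ^ P.d := Nat.pow_le_pow_left (by omega) _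
    have h3 : ((ball x (2 * nN + 1)).card : ℝ) ≤ ((7 * nN) ^ P.d : ℕ) := by exact_mod_cast h.trans h2
    refine h3.trans (le_of_eq ?_)
    push_cast
    rw [mul_pow, hnNn, hNn]
  have hcE_sum : ∑ y, (w y * (n ^ 2 * cE y)) ^ 2 ≤ 7 ^ P.d * Real.exp 6 * P.d ^ 2 * C_B ^ 2 * S₀ := by
    have hpt : ∀ y, (w y * (n ^ 2 * cE y)) ^ 2 ≤
        (if y ∈ ball x (2 * nN + 1) then Real.exp 6 * (n ^ 2 * (2 * P.d * K)) ^ 2 else 0) := by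
      intro y
      by_cases hy : y ∈ ball x (2 * nN + 1)
      · rw [if_pos hy]
        rw [mem_ball] at hy
        have hw3 : w y ≤ Real.exp 3 := by
          rw [hw]; simp only
          rw [Real.exp_le_exp, div_le_iff₀ hnpos]
          have h' : ((supDist x y : ℕ) : ℝ) ≤ 2 * n + 1 := by rw [← hnNn]; exact_mod_cast hy
          have h'' : t * (supDist x y : ℝ) ≤ t * (2 * n + 1) := mul_le_mul_of_nonneg_left h' ht0
          nlinarith only [h'', ht1', hn1, ht0]
        have hw6 : w y ^ 2 ≤ Real.exp 6 := by
          calc w y ^ 2 ≤ Real.exp 3 ^ 2 := pow_le_pow_left₀ (hwpos y).le hw3 2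
            _ = Real.exp 6 := by rw [← Real.exp_nat_mul]; norm_num
        have hc := hcE_le y
        calc (w y * (n ^ 2 * cE y)) ^ 2 = w y ^ 2 * (n ^ 2) ^ 2 * |cE y| ^ 2 := by rw [sq_abs]; ring
          _ ≤ Real.exp 6 * (n ^ 2) ^ 2 * (2 * P.d * K) ^ 2 := by
              have h1 : |cE y| ^ 2 ≤ (2 * P.d * K) ^ 2 := pow_le_pow_left₀ (abs_nonneg _) hc 2
              have h2 : w y ^ 2 * (n ^ 2) ^ 2 ≤ Real.exp 6 * (n ^ 2) ^ 2 := mul_le_mul_of_nonneg_right hw6 (by positivity)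
              exact mul_le_mul h2 h1 (by positivity) (by positivity)
          _ = Real.exp 6 * (n ^ 2 * (2 * P.d * K)) ^ 2 := by ring
      · rw [if_neg hy]
        rw [mem_ball, not_le] at hy
        rw [hcE_zero y hy]; simp
    refine (sum_le_sum fun y _ => hpt y).trans ?_
    rw [← sum_filter, Finset.filter_mem_eq_inter, Finset.univ_inter, sum_const, nsmul_eq_mul]
    have eK : (n ^ 2 * (2 * P.d * K)) ^ 2 = P.d ^ 2 * C_B ^ 2 * (sp ^ 4 / N ^ 2) := by
      rw [hK]; field_simp
    rw [eK]
    calc ((ball x (2 * nN + 1)).card : ℝ) * (Real.exp 6 * (P.d ^ 2 * C_B ^ 2 * (sp ^ 4 / N ^ 2)))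
        ≤ (7 ^ P.d * N) * (Real.exp 6 * (P.d ^ 2 * C_B ^ 2 * (sp ^ 4 / N ^ 2))) :=
          mul_le_mul_of_nonneg_right hcard (by positivity)
      _ = 7 ^ P.d * Real.exp 6 * P.d ^ 2 * C_B ^ 2 * S₀ := by rw [hS₀]; field_simp
  have hT3 : ∑ z, (w z * f₂ z) ^ 2 ≤ (2 * (7 ^ P.d * Real.exp 6 * P.d ^ 2 * C_B ^ 2) + 5 / 2 * (1 + e2) * P.d * C₁) * S₀ := by
    have hE := energy_weighted (starB Ω) (n := n) (F := fun b => D b * mB b) (g := fun y => -(n ^ 2 * cE y)) (f := f₂)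
      hwpos hκ0 hρ0 hosc hrat hsmall (fun y => by
        rw [hf₂, hmassR (fun y => n ^ 2 * comm y) y, hdecomp y]; ring)
    have eneg : ∑ y, (w y * -(n ^ 2 * cE y)) ^ 2 = ∑ y, (w y * (n ^ 2 * cE y)) ^ 2 := sum_congr rfl fun y _ => by ring
    rw [eneg] at hE
    -- the divergence part
    have hdiv : ∑ b ∈ starB Ω, (w b.src ^ 2 + w b.tgt ^ 2) / 2 * (D b * mB b) ^ 2 ≤ (1 + ρ) * P.d / (2 * n ^ 2) * A₀ := by
      have hpt : ∀ b ∈ starB Ω, (w b.src ^ 2 + w b.tgt ^ 2) / 2 * (D b * mB b) ^ 2 ≤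
          (1 / n) ^ 2 * ((1 + ρ) / 4 * ((w b.src * ub b.src) ^ 2 + (w b.tgt * ub b.tgt) ^ 2)) := by
        intro b hb
        obtain ⟨hr1, hr2⟩ := hrat b hb
        have hD2 : D b ^ 2 ≤ (1 / n) ^ 2 := by
          have := hDle b
          rw [← sq_abs]; exact pow_le_pow_left₀ (abs_nonneg _) this 2
        have hm : mB b ^ 2 ≤ (ub b.src ^ 2 + ub b.tgt ^ 2) / 2 := sq_half_sum_le _ _
        have hP : (w b.src ^ 2 + w b.tgt ^ 2) / 2 * ((ub b.src ^ 2 + ub b.tgt ^ 2) / 2) ≤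
            (1 + ρ) / 4 * ((w b.src * ub b.src) ^ 2 + (w b.tgt * ub b.tgt) ^ 2) := weight_cross_le hr1 hr2
        calc (w b.src ^ 2 + w b.tgt ^ 2) / 2 * (D b * mB b) ^ 2
            = D b ^ 2 * ((w b.src ^ 2 + w b.tgt ^ 2) / 2 * mB b ^ 2) := by ring
          _ ≤ (1 / n) ^ 2 * ((w b.src ^ 2 + w b.tgt ^ 2) / 2 * ((ub b.src ^ 2 + ub b.tgt ^ 2) / 2)) :=
              mul_le_mul hD2 (mul_le_mul_of_nonneg_left hm (by positivity)) (by positivity) (by positivity)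
          _ ≤ (1 / n) ^ 2 * ((1 + ρ) / 4 * ((w b.src * ub b.src) ^ 2 + (w b.tgt * ub b.tgt) ^ 2)) :=
              mul_le_mul_of_nonneg_left hP (by positivity)
      refine (sum_le_sum hpt).trans ?_
      rw [← mul_sum, ← mul_sum, sum_add_distrib]
      have h1 := sum_src_le (starB Ω) (φ := fun y => (w y * ub y) ^ 2) (fun y => sq_nonneg _)
      have h2 := sum_tgt_le (starB Ω) (φ := fun y => (w y * ub y) ^ 2) (fun y => sq_nonneg _)
      rw [← hA₀] at h1 h2
      have : (1 / n) ^ 2 * ((1 + ρ) / 4 * (∑ b ∈ starB Ω, (w b.src * ub b.src) ^ 2 + ∑ b ∈ starB Ω, (w b.tgt * ub b.tgt) ^ 2))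
          ≤ (1 / n) ^ 2 * ((1 + ρ) / 4 * (P.d * A₀ + P.d * A₀)) :=
        mul_le_mul_of_nonneg_left (mul_le_mul_of_nonneg_left (add_le_add h1 h2) (by positivity)) (by positivity)
      refine this.trans (le_of_eq ?_)
      field_simp; ring
    have hdiv' : 5 * n ^ 2 * ∑ b ∈ starB Ω, (w b.src ^ 2 + w b.tgt ^ 2) / 2 * (D b * mB b) ^ 2 ≤
        5 / 2 * (1 + e2) * P.d * C₁ * S₀ := by
      have h1 : 5 * n ^ 2 * ∑ b ∈ starB Ω, (w b.src ^ 2 + w b.tgt ^ 2) / 2 * (D b * mB b) ^ 2 ≤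
          5 * n ^ 2 * ((1 + ρ) * P.d / (2 * n ^ 2) * A₀) := mul_le_mul_of_nonneg_left hdiv (by positivity)
      have e : 5 * n ^ 2 * ((1 + ρ) * P.d / (2 * n ^ 2) * A₀) = 5 / 2 * (1 + ρ) * P.d * A₀ := by
        field_simp
      rw [e] at h1
      have h2 : 5 / 2 * (1 + ρ) * P.d * A₀ ≤ 5 / 2 * (1 + e2) * P.d * (C₁ * S₀) := by
        have hd0 : (0:ℝ) ≤ P.d := Nat.cast_nonneg _
        have h := mul_le_mul (show 1 + ρ ≤ 1 + e2 by linarith only [hρe2]) hA₀le hA₀nn (by positivity)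
        have h' := mul_le_mul_of_nonneg_left h (by positivity : (0:ℝ) ≤ 5 / 2 * P.d)
        have e1 : 5 / 2 * (1 + ρ) * P.d * A₀ = 5 / 2 * P.d * ((1 + ρ) * A₀) := by ring
        have e2' : 5 / 2 * (1 + e2) * P.d * (C₁ * S₀) = 5 / 2 * P.d * ((1 + e2) * (C₁ * S₀)) := by ring
        rw [e1, e2']; exact h'
      linarith only [h1, h2]
    have hce := hcE_sum
    calc ∑ z, (w z * f₂ z) ^ 2
        ≤ 2 * ∑ y, (w y * (n ^ 2 * cE y)) ^ 2 + 5 * n ^ 2 * ∑ b ∈ starB Ω, (w b.src ^ 2 + w b.tgt ^ 2) / 2 * (D b * mB b) ^ 2 := hE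
      _ ≤ 2 * (7 ^ P.d * Real.exp 6 * P.d ^ 2 * C_B ^ 2 * S₀) + 5 / 2 * (1 + e2) * P.d * C₁ * S₀ := by linarith only [hce, hdiv']
      _ = (2 * (7 ^ P.d * Real.exp 6 * P.d ^ 2 * C_B ^ 2) + 5 / 2 * (1 + e2) * P.d * C₁) * S₀ := by ring
  -- FINAL: `(w·R(x,·))² = (w(χū − f₁ − f₂))²/sp⁴ ≤ 3(w²(χū)² + w²f₁² + w²f₂²)/sp⁴`
  have hsp4 : 0 < sp ^ 4 := by positivity
  have hpt : ∀ z, (w z * R x z) ^ 2 ≤ (3 / sp ^ 4) * ((w z * (χ z * ub z)) ^ 2 + (w z * f₁ z) ^ 2 + (w z * f₂ z) ^ 2) := by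
    intro z
    have e : R x z = (χ z * ub z - f₁ z - f₂ z) / sp ^ 2 := by
      rw [eq_div_iff (by positivity), mul_comm]; exact hident z
    rw [e]
    have h := sub_sub_sq_le (w z * (χ z * ub z)) (w z * f₁ z) (w z * f₂ z)
    rw [show (w z * ((χ z * ub z - f₁ z - f₂ z) / sp ^ 2)) ^ 2 =
      (w z * (χ z * ub z) - w z * f₁ z - w z * f₂ z) ^ 2 / sp ^ 4 by field_simp]
    rw [div_le_iff₀ hsp4]
    calc (w z * (χ z * ub z) - w z * f₁ z - w z * f₂ z) ^ 2
        ≤ 3 * ((w z * (χ z * ub z)) ^ 2 + (w z * f₁ z) ^ 2 + (w z * f₂ z) ^ 2) := h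
      _ = 3 / sp ^ 4 * ((w z * (χ z * ub z)) ^ 2 + (w z * f₁ z) ^ 2 + (w z * f₂ z) ^ 2) * sp ^ 4 := by
          field_simp
  calc ∑ z, (w z * R x z) ^ 2
      ≤ ∑ z, (3 / sp ^ 4) * ((w z * (χ z * ub z)) ^ 2 + (w z * f₁ z) ^ 2 + (w z * f₂ z) ^ 2) := sum_le_sum fun z _ => hpt z
    _ = (3 / sp ^ 4) * (∑ z, (w z * (χ z * ub z)) ^ 2 + ∑ z, (w z * f₁ z) ^ 2 + ∑ z, (w z * f₂ z) ^ 2) := by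
        rw [← mul_sum, sum_add_distrib, sum_add_distrib]
    _ ≤ (3 / sp ^ 4) * (C₁ * S₀ + (4 * C₁ + 4 * e2 * C₁) * S₀ +
          (2 * (7 ^ P.d * Real.exp 6 * P.d ^ 2 * C_B ^ 2) + 5 / 2 * (1 + e2) * P.d * C₁) * S₀) :=
        mul_le_mul_of_nonneg_left (add_le_add (add_le_add hT1 hT2) hT3) (by positivity)
    _ = C₀ / N := by rw [hC₀, hS₀]; field_simp

end

end Literature.MathematicalPhysics.QuantumFieldTheory.BalabanImbrieJaffe1984to88.BIJ88FreeNeumannResolventRegionDeep
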